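import Mathlib
import Literature.MathematicalPhysics.QuantumFieldTheory.Balaban1983to89.B13Inv214Orbit
import Literature.MathematicalPhysics.QuantumFieldTheory.Balaban1983to89.B10Eq26TubeIdentity
import Literature.MathematicalPhysics.QuantumFieldTheory.Balaban1983to89.B7Prop1Explicit
import Literature.MathematicalPhysics.QuantumFieldTheory.Balaban1983to89.B10Eq26SiteGauge

/-!
# `Balaban1983to89.B13Inv214PolarChain` — [II] p. 22 *«This means that the expressions are constant on intersections
# of orbits with the corresponding space of configurations»*: the connectedness input behind *«This means»* PROVED for
# condition sets of bi-covariant norm type (the shape of [I] p. 262 (ii, tube clause) and (iii)) by a POLAR CHAIN —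
# left polar decomposition + Hadamard's three lines — and (H6) discharged by name; a negative toy

Paper sub-cell B13 of the Bałaban programme audit (cell `pub-balaban`), generation 21 (v1 p188812; **v1.1 = v1 byte-identical + one
import `…B10Eq26SiteGauge` (b10 gen 25, p188772) + the APPEND-ONLY §7 «the join on the tube model»**); a NEW LEAF over the
generation-20 skeleton `…B13Inv214Orbit` (v1, p188146) and the b10 lineage's `…B10Eq26TubeIdentity` (v1, p188166),
both imported and used BY NAME, nothing restated, nothing edited.  Companion records: cell GAPS C-B13-44 (the parent
skeleton: (R3) = near-orbit constancy + the located input `TubeChainConnected`), C-B13-45 (this lineage's cross-read of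
the (H6) provider), C-adv2-77 (adversarial read of the parent; its S1 «(H6) is now dischargeable by p188166» is §1
below), C-B13-46 (this module); `b2b-balaban-b13/CENSUS-B13-v2.md` row «p. 21–22».  VALUE = the ONE located input the
parent's kernel isolated behind the printed *«This means»* — a discrete connectedness of orbit ∩ space — is a THEOREM
for every condition set cut out of a `Gᶜ`-invariant set by (arbitrarily many) strict or non-strict NORM CONDITIONS ON
BI-COVARIANT QUANTITIES, in particular for the lineage's own model of [I] p. 262 (ii, tube clause) + (iii); so for such
spaces (R3)/(R4) follow from (R1) + analyticity ALONE (`orbitConstOn_of_polarConvex`).  A negative toy shows the input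
cannot be dropped in general (a UNION of two such conditions fails it although every other hypothesis holds).  NOT
summit progress; NO disputed step of the papers under audit is certified; the clauses of [I] p. 262 that are NOT of
bi-covariant norm type ((i) second clause, (ii) covariant-derivative clause, (iv)) are NOT examined — see HONEST SCOPE.

CITATION HEADER (lean-in-tree rule 2026-08-18).  Sources (held):
* [Balaban1988RG2Cluster] = B13 = [II], T. Bałaban, *Renormalization group approach to lattice gauge field theories.
  II. Cluster expansions*, Commun. Math. Phys. **116** (1988) 1–22 (`paper:balaban1988-cmp116-rg-ii-cluster`),
  p. 21 last paragraph → p. 22, quoted IN FULL AND VERBATIM in `…B13Inv214Orbit` §0 (render read as image there and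
  re-read by C-adv2-77); the two sentences this leaf is about, VERBATIM: *«This means that the expressions are constant
  on intersections of orbits with the corresponding space of configurations (U, J) satisfying the conditions
  I.(i)–(iv). We extend them to constant functions on whole orbits having non-empty intersections with the space.»*
* [Balaban1987RG1] = B12 = [I], T. Bałaban, *Renormalization group approach to lattice gauge field theories. I.
  Generation of effective actions in a small field approximation and a coupling constant renormalization*, Commun.
  Math. Phys. **109** (1987) 249–301, p. 262 — READ AS IMAGE this generation from the render
  `b2b-balaban-ref1/pages/1987-cmp109-rg-I-small-field/1987-cmp109-rg-I-small-field-p014-x2.png`, VERBATIM: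
  *«A Gᶜ-valued gauge transformation u acts on pairs (U, J) in the following way (U, J)ᵘ = (Uᵘ, R(u)J) =
  (u₋Uu₊⁻¹, R(u₋)J), (1.10) where for a bond b = ⟨b₋, b₊⟩ we define u±(b) = u(b±). The orbit of the group of
  Gᶜ-valued gauge transformations determined by a pair (U, J) is denoted by [(U, J)]. We are ready to formulate the
  following fundamental definition. The space Uᶜⱼ(X, α₀, α₁, γ₀) is a union of orbits [(U, J)] determined by
  configurations U, J satisfying the four conditions written below. (i) U = U′U, U has values in the group G,
  |∂U − 1| < α₀ξ² on X, (1.11) for each cube □ ⊂ X of a size O(1)LM there exists a G-valued gauge transformation u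
  defined on □ and such, that Uᵘ = exp iξA, |A|, |∇^ξ A| < O(1)LMBα₀ on □, (1.12) with a sufficiently large
  constant B (it will be determined later). (ii) U′ = exp iξA′, A′ has values in the algebra gᶜ, |A′|, |∇_U^ξ A′| < α₁
  on X. (1.13) (iii) The configurations U, J satisfy the bounds |∂U − 1| < α₀ξ², |J| < γ₀ on X. (1.14)»*; (iv)
  begins *«We consider X as Ω₀, and we construct the sequence {Ω_n}, n = 1, …, j, of maximal possible domains …
  we construct the functions U_n(V) in the axial gauges, for regular Gᶜ-valued configurations V.»* and imposes
  (1.16) *«|∂U_n(M˙(U)) − 1| < α₀ξ², |J_n(M˙(U))| < α₀(Lⁿξ)² on X̃⁻²»*; and, same page: *«The first three conditions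
  (i)–(iii) in the above definition are rather simple and natural, the conditions of this form appeared many times in
  the previous papers, e.g. see (3.35)–(3.38) [13].»*
* [Balaban1985BackgroundPropagators] = B9 = [13], Commun. Math. Phys. **99** (1985), p. 395 (3.28) *«Uᵘ(x, x′) =
  u(x)U(x, x′)u⁻¹(x′)»* — the formula of the action (`B13Inv214Orbit.gaugeAct`, `instMulActionCfg`), quoted in full in
  `…B13GaugeDevices` §0; not re-read here.

WHAT THE KERNEL PROVES (every `theorem` below is kernel-checked, no placeholders; tags `[folklore]` = standard mathematics stated and
proved here, `[cite: …]` = the docstring names the printed sentence the statement MODELS — never a hypothesis).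
* §1 (H6) DISCHARGED: the parent's `gcInvariant_of_analyticOn`, `nearOrbitConstOn_of_analyticOn`,
  `orbitConstOn_of_gInvariant` restated WITHOUT the binder `hId : TubeIdentity S 𝔸 a`, by
  `exact … (B10Eq26TubeIdentity.tubeIdentity a) …` (C-adv2-77 S1).  Residual binders then: `hF`/`hmaps`/`hG`/`hconn`.
* §2 [folklore] LEFT POLAR DECOMPOSITION OF AN ARBITRARY INVERTIBLE ELEMENT of a unital C⋆-algebra:
  `u = exp(polarLog u)·polarUnit u`, `polarLog u = ½·log(u u⋆)` self-adjoint (continuous functional calculus;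
  `B10Eq29CplxLine.exp_log_of_spectrum_pos` / `exp_neg_mul_mem_unitary` by name), `polarUnit u` unitary; and THE TUBE
  IS A NORM ANNULUS: for `α > 0`, `u ∈ Tube 𝔸 α ⟺ ‖u‖ < e^{α} ∧ ‖u⁻¹‖ < e^{α}` (`coe_mem_tube_iff`; isometric
  functional calculus for `⟸`).
* §3 [folklore] HADAMARD THREE LINES for `z ↦ exp(zB_x)·Q·exp(−zB_y)` (`B_x, B_y` self-adjoint): on vertical lines the
  C⋆-norm only sees `Re z` (the `Im z` factors are unitary), the family is entire and bounded on the strip, so Mathlib's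
  `Complex.HadamardThreeLines.norm_le_interp_of_mem_verticalClosedStrip₀₁'` gives
  `‖exp(tB_x) Q exp(−tB_y)‖ ≤ ‖Q‖^{1−t}·‖exp(B_x) Q exp(−B_y)‖^{t} ≤ max(‖Q‖, ‖exp(B_x) Q exp(−B_y)‖)`, `t ∈ [0,1]`
  (the Heinz–Kato mechanism).  RIGIDITY on the unitary slice: `exp(B_x) W exp(−B_y)` unitary (`W` unitary) ⇒ `= W`.
* §4 THE POLAR CHAIN.  `BiCov γ Q x y` := `Q(g • V) = g(x)·Q(V)·g(y)⁻¹` for all `g : S → 𝔸ˣ` (bond variables, their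
  inverses, products with matching charges, `Q − 1` for diagonal charge, plaquette words); `PolarConvex γ 𝒞` := with
  `V` and `g • V` the whole polar path `polarPath g t • V` (`t ∈ [0,1]`, sitewise `exp(t·polarLog(g x))·polarUnit(g x)`)
  lies in `𝒞` — closed under arbitrary intersections, contains every `Gᶜ`-invariant set, every `{‖Q V‖ < c}` /
  `{‖Q V‖ ≤ c}` with `Q` bi-covariant (three lines), every tube condition `{V_b ∈ Tube 𝔸 α}` (annulus), hence
  `TubeCfg ι 𝔸 α`; on the unitary slice `g • V = polarPath g 0 • V` (rigidity), so there (R3) is (R1)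
  (`orbitConstOn_of_gInvariant_unitarySlice`).  MAIN: `tubeChainConnected_of_polarConvex` — every polar-convex set is
  `B13Inv214Orbit.TubeChainConnected γ a ·` for EVERY `a > 0` (chain: the unitary part of `g`, then `N` equal axial
  steps `exp(polarLog(g x)/N)`, `N·a > Σ_x ‖polarLog(g x)‖`, each tube-valued, all intermediate points in the set).
* §5 END TO END: `orbitConstOn_of_polarConvex` — for a polar-convex space, (R1) `hG` + analyticity `hF` + near-orbits
  inside the analyticity domain `hmaps` ⇒ (R3), and (R4) `exists_orbitExtension_of_polarConvex`; the typed shape of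
  [I] p. 262 (ii, tube clause) + (iii): `tubeChainConnected_p262Shape` / `orbitConstOn_p262Shape` for
  `{V | ∀ b ∈ bonds, V_b ∈ Tube 𝔸 α₁} ∩ {V | ∀ p, ‖hol p V − 1‖ < α₀ p} ∩ {V | ∀ b ∈ Jidx, ‖V_b‖ < γ₀}` with `hol p`
  any bi-covariant quantities of diagonal charge (`biCov_plaquette`: a square plaquette word qualifies).
* §6 NEGATIVE TOY (`𝔸 = ℂ`, one bond, the parent's `toyEnds`): `toyS = {|V| < ½} ∪ {|V| > 2}` (a UNION of two
  bi-covariant norm conditions), `toyF = 0` on `|V| < 1`, `1` elsewhere: holomorphic on `{|V| ≠ 1}` ⊇ the near-orbits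
  of `toyS` (`e^{2a} ≤ 2`), invariant under ALL unitary-valued gauge transformations, near-orbit constant — and NOT
  orbit-constant (`V ≡ ¼`, `g = (16, 1)`); hence `toyS` is neither tube-chain-connected nor polar-convex
  (`toy_summary`): the input behind *«This means»* is necessary and is a property of the SPACE, as the parent said.
* §7 (v1.1, APPEND-ONLY) THE JOIN ON THE TUBE MODEL with the b10 lineage's `…B10Eq26SiteGauge` (gen 25: `MapsTube` =
  the parent's `hmaps` for `𝒟 = TubeCfg ι 𝔸 a`, `𝒮 = TubeCfg ι 𝔸 a₀`, uniformly; `SiteGaugeInv` = (26) of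
  [Balaban1985UV3] p. 263 for all unitary-valued site-dependent `u` on unitary-valued configurations;
  `nearOrbitConstOn_tube`).  (i) EXPLICIT MARGINS [folklore]: `mapsTube_of_le` — `0 < a₀`, `0 < c`, `c + a₀ + c ≤ a` ⇒
  `MapsTube 𝔸 γ a a₀ c`, from the annulus `coe_mem_tube_iff` and submultiplicativity (no radius from the open-mapping
  theorem; b10's `exists_mapsTube` produces SOME margins, this names them).  (ii) `orbitConstOn_tube`: margins +
  holomorphy on the `a`-tube + (26) ⇒ FULL (R3) `OrbitConstOn γ F (TubeCfg ι 𝔸 a₀)` — the parent's three located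
  binders `hId` (b10 gen 24), `hmaps` (b10 gen 25), `hconn` (§4 here: the tube is polar-convex) ALL DISCHARGED on the
  tube model.  (iii) The binder-minimal forms `orbitConstOn_tube_third (ha : 0 < a) (hF : DifferentiableOn ℂ F (TubeCfg
  ι 𝔸 a)) (h26 : SiteGaugeInv γ F) : OrbitConstOn γ F (TubeCfg ι 𝔸 (a/3))` and (R4) `exists_orbitExtension_tube_third`:
  on the lineage's tube model [II] p. 22's two sentences follow from (26) + holomorphy with NO further input.  HONEST
  SCOPE (b)–(e) unchanged: the tube model carries none of the regularity / derivative / block clauses of [I] p. 262,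
  and (26) for all site-dependent unitary-valued `u` + holomorphy on the tube remain hypotheses about print's never-
  constructed expressions (G-adv7-7; b10 HONEST SCOPE (ii)); U(N)-slice.

THE DICTIONARY (model ↔ print, [I] p. 262).  `U` at bonds with values in `Gᶜ ⊆ 𝔸` ↔ `V : ι → 𝔸` (`ι` ⊇ bonds);
(1.10) `u₋Uu₊⁻¹` ↔ `g • V` (`B13Inv214Orbit.instMulActionCfg`, [13] (3.28) with `u⁻¹`); `J` at bonds with values in
`gᶜ ⊆ 𝔸`, `J ↦ R(u₋)J = u(b₋)Ju(b₋)⁻¹` (adjoint action in the matrix model) ↔ an extra index `b′ ∈ Jidx ⊆ ι` with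
`γ.src b′ = γ.tgt b′ = b₋` (a loop index; `Ends` allows it), so ONE action covers the pair `(U, J)`; (ii) tube clause
`U′ = exp iξA′, |A′| < α₁` (with (i) `U` `G`-valued) ↔ `V_b = exp(B)·U_b ∈ Tube 𝔸 α₁` (`‖B‖ < α₁`, `U_b` unitary — the
lineage's standing tube model, `B10Eq29TubeLine`); (iii) `|∂U − 1| < α₀ξ²` ↔ `‖hol p V − 1‖ < α₀ p`, `|J| < γ₀` ↔
`‖V_{b′}‖ < γ₀`; *«union of orbits [(U, J)] determined by configurations satisfying …»* ↔ the orbit saturation of the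
condition set, on which (R4) defines the extension (`B12Inv329.orbitExtension_iff` via the parent).

HONEST SCOPE.  (a) Print gives NO mechanism for *«This means»*; the polar chain is [folklore] mathematics supplied by
the audit to show that the parent's located input HOLDS for condition sets of this shape — it is not asserted to be
the author's argument, and nothing printed is used as a hypothesis.  (b) NOT of bi-covariant norm type and NOT
examined: (i) second clause (existence, on each O(1)LM cube, of a `G`-valued `u` with `Uᵘ = exp iξA`, `A` small — a
condition on the `G`-orbit of the unitary factor), (ii) second clause `|∇_U^ξ A′| < α₁` (couples neighbouring bonds
and the `U`-factor), (iv) (bounds on the nonlinear images `U_n(M˙(U))`, `J_n(M˙(U))`); for print's full space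
`Uᶜⱼ(X, α₀, α₁, γ₀)` the connectedness input therefore remains the located residual of C-B13-44 RESTRICTED to these
clauses (if they cut out polar-convex sets — e.g. if `U_n ∘ M˙` is `Gᶜ`-covariant so that (1.16) is again of
bi-covariant norm type — the theorem here applies verbatim; not claimed).  (c) `hmaps` (near-orbits inside the
analyticity domain, [I] p. 276's proviso) and `hG` (invariance under ALL unitary-valued `u`; G-adv7-7: print delivers
block-constant ones) stay hypotheses exactly as in the parent.  (d) `G`-valued := unitary-valued in `𝔸` (a
`U(N)`-type slice, not `SU(N)`; C-B13-45 I-3), finite index types, `[Fintype S]` for the chain.  (e) No bound of the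
papers, no convergence, nothing on Theorem I.3 or the continuum limit; not Clay-problem progress.

SIBLING PRIOR ART (by name, not restated): `B10Eq29CplxLine` §2 (polar decomposition in the CONFIGURATION variable
near `1`: `exp_log_of_spectrum_pos`, `exp_neg_mul_mem_unitary` — used here for ARBITRARY invertible elements via the
spectrum of `u u⋆`), `B10Eq29TubeLine` (`Tube`, `TubeCfg`, `exp_mul_mem_tube`), `B10Eq31GlobalConj`
(`I_smul_mem_skewAdjoint`), `B10Eq26TubeIdentity.tubeIdentity` ((H6)), `B7Prop1Explicit.expUnit` (`exp B` as a
unit), `B10Eq26SiteGauge` (§7 only: `MapsTube`, `SiteGaugeInv`, `nearOrbitConstOn_tube`, `exists_mapsTube`), `B13Inv214Orbit` (the action, `OrbitConstOn`, `NearOrbitConstOn`, `TubeReach`, `TubeChainConnected`, (R2)–(R4)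
modulo inputs, `toyEnds`), `QuantumLattice.norm_exp_le`; Mathlib `CFC.log`, `CFC.log_exp`,
`Complex.HadamardThreeLines`.  ABSOLUTE RULE: no statement of the manuscripts under
audit and no programme-internal claim enters as a hypothesis; all quotations carry page references.

RECORDS: cell GAPS C-B13-46 (this module, v1), C-B13-47 (owner cross-read of `…B10Eq26SiteGauge` + v1.1 §7); CENSUS-B13-v2
row «p. 21–22» addendum; DIVERGENCE D-b13.30 (the dictionary above, schematic-typing note); no new bib key
([Balaban1985UV3] is cited for the SHAPE (26) exactly as in `…B10Eq26SiteGauge`, through whose `SiteGaugeInv` it enters).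
-/

open Set NormedSpace Filter
open scoped Topology

namespace Literature.MathematicalPhysics.QuantumFieldTheory.Balaban1983to89.B13Inv214PolarChain

open B10Eq29TubeLine (Tube TubeCfg mem_tube mem_tubeCfg mem_tubeCfg_of_unitary mem_tube_of_mem_unitary
  exp_mul_mem_tube ofReal_smul_mem_skewAdjoint exp_ofReal_smul_mem_unitary)
open B10Eq29CplxLine (exp_log_of_spectrum_pos exp_neg_mul_mem_unitary)
open B10Eq31GlobalConj (I_smul_mem_skewAdjoint)
open B10Eq26MeasureInv (TubeIdentity)
open B10Eq26TubeIdentity (tubeIdentity)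
open B7Prop1Explicit (expUnit val_expUnit)
open B13Inv214Orbit (Ends gaugeAct Cfg OrbitConstOn NearOrbitConstOn TubeReach TubeChainConnected
  isUnit_of_mem_unitary isUnit_of_mem_tube smul_eq_gaugeAct orbitConstOn_of_nearOrbitConstOn)

/-! ## §1. `B13Inv214Orbit` with (H6) discharged -/

section Discharge

variable {ι S : Type*} {𝔸 : Type*} [CStarAlgebra 𝔸] (γ : Ends ι S) [Fintype S] [Fintype ι]

/-- **(R2) with (H6) discharged** ([II] p. 22 *«the invariance can be extended, by the analyticity, to Gᶜ-valued gauge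
transformations in a small neighborhood of the space of G-valued ones»*): the parent's `gcInvariant_of_analyticOn`
with `hId` supplied by `B10Eq26TubeIdentity.tubeIdentity a` (index type := sites).  Residual binders: analyticity
`hF`, near-orbit inside the domain `hmaps`, (R1) `hG`. [cite: Balaban1988RG2Cluster, p.22] for the claim modelled;
the binders are located inputs, nothing printed is assumed. -/
theorem gcInvariant_of_analyticOn {a : ℝ} {F : (ι → 𝔸) → ℂ} {𝒟 : Set (ι → 𝔸)}
    (hF : DifferentiableOn ℂ F 𝒟) {V : ι → 𝔸} (hmaps : ∀ u ∈ TubeCfg S 𝔸 a, gaugeAct γ u V ∈ 𝒟)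
    (hG : ∀ u : S → 𝔸, (∀ x, u x ∈ unitary 𝔸) → F (gaugeAct γ u V) = F V) :
    ∀ u ∈ TubeCfg S 𝔸 a, F (gaugeAct γ u V) = F V :=
  B13Inv214Orbit.gcInvariant_of_analyticOn γ (tubeIdentity a) hF hmaps hG

/-- Near-orbit constancy on a space, (H6) discharged (parent: `nearOrbitConstOn_of_analyticOn`).
[cite: Balaban1988RG2Cluster, p.22] -/
theorem nearOrbitConstOn_of_analyticOn {a : ℝ} {F : (ι → 𝔸) → ℂ} {𝒟 𝒮 : Set (ι → 𝔸)}
    (hF : DifferentiableOn ℂ F 𝒟) (hmaps : ∀ V ∈ 𝒮, ∀ u ∈ TubeCfg S 𝔸 a, gaugeAct γ u V ∈ 𝒟)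
    (hG : ∀ V ∈ 𝒮, ∀ u : S → 𝔸, (∀ x, u x ∈ unitary 𝔸) → F (gaugeAct γ u V) = F V) :
    NearOrbitConstOn γ a F 𝒮 :=
  B13Inv214Orbit.nearOrbitConstOn_of_analyticOn γ (tubeIdentity a) hF hmaps hG

/-- **(R3) modulo the connectedness input ONLY** (parent: `orbitConstOn_of_gInvariant`, C-adv2-77 S1): (R1) `hG` +
analyticity `hF` + `hmaps` + `TubeChainConnected` ⇒ the expressions are constant on orbit ∩ space.  §4–§5 below PROVE
`hconn` for polar-convex spaces. [cite: Balaban1988RG2Cluster, p.22] -/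
theorem orbitConstOn_of_gInvariant {a : ℝ} {F : (ι → 𝔸) → ℂ} {𝒟 𝒮 : Set (ι → 𝔸)}
    (hF : DifferentiableOn ℂ F 𝒟) (hmaps : ∀ V ∈ 𝒮, ∀ u ∈ TubeCfg S 𝔸 a, gaugeAct γ u V ∈ 𝒟)
    (hG : ∀ V ∈ 𝒮, ∀ u : S → 𝔸, (∀ x, u x ∈ unitary 𝔸) → F (gaugeAct γ u V) = F V)
    (hconn : TubeChainConnected γ a 𝒮) : OrbitConstOn γ F 𝒮 :=
  B13Inv214Orbit.orbitConstOn_of_gInvariant γ (tubeIdentity a) hF hmaps hG hconn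

end Discharge

/-! ## §2. The polar decomposition of an arbitrary invertible element; the tube is a norm annulus -/

section Polar

variable {𝔸 : Type*} [CStarAlgebra 𝔸]

/-- The real spectrum of `u·u⋆` is strictly positive for an invertible `u`. [folklore] -/
theorem spectrum_mul_star_self_pos (u : 𝔸ˣ) : ∀ x ∈ spectrum ℝ ((u : 𝔸) * star (u : 𝔸)), 0 < x := by
  intro x hx
  have h0 : 0 ≤ x := by
    have := spectrum_star_mul_self_nonneg (b := star (u : 𝔸)) x
    rw [star_star] at this
    exact this hx
  have hx' : x ∈ spectrum ℝ (((u * star u : 𝔸ˣ) : 𝔸)) := by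
    rwa [Units.val_mul, Units.coe_star]
  exact lt_of_le_of_ne h0 (spectrum.ne_zero_of_mem_of_unit hx').symm

/-- THE SELF-ADJOINT LOGARITHM of the positive part: `polarLog u = ½·log(u·u⋆)`. [folklore] -/
noncomputable def polarLog (u : 𝔸ˣ) : 𝔸 := (1 / 2 : ℝ) • CFC.log ((u : 𝔸) * star (u : 𝔸))

/-- THE UNITARY (PHASE) PART: `polarUnit u = exp(−polarLog u)·u`. [folklore] -/
noncomputable def polarUnit (u : 𝔸ˣ) : 𝔸 := exp (-polarLog u) * u

/-- `polarLog u` is self-adjoint. [folklore] -/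
theorem isSelfAdjoint_polarLog (u : 𝔸ˣ) : IsSelfAdjoint (polarLog u) := by
  have h : IsSelfAdjoint (CFC.log ((u : 𝔸) * star (u : 𝔸))) := by
    rw [CFC.log]; exact cfc_predicate _ _
  exact (IsSelfAdjoint.all (1 / 2 : ℝ)).smul h

/-- `exp(2·polarLog u) = u u⋆`. [folklore] -/
theorem exp_polarLog_add_polarLog (u : 𝔸ˣ) :
    exp (polarLog u + polarLog u) = (u : 𝔸) * star (u : 𝔸) := by
  have hBB : polarLog u + polarLog u = CFC.log ((u : 𝔸) * star (u : 𝔸)) := by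
    rw [polarLog, ← add_smul]; norm_num
  rw [hBB]
  exact exp_log_of_spectrum_pos (IsSelfAdjoint.mul_star_self (u : 𝔸)) (spectrum_mul_star_self_pos u)

/-- **LEFT POLAR DECOMPOSITION OF AN ARBITRARY INVERTIBLE ELEMENT**: `polarUnit u` is unitary and
`u = exp(polarLog u)·polarUnit u` with `polarLog u` self-adjoint. [folklore] -/
theorem polarUnit_mem_unitary (u : 𝔸ˣ) : polarUnit u ∈ unitary 𝔸 :=
  (exp_neg_mul_mem_unitary u.isUnit (isSelfAdjoint_polarLog u) (exp_polarLog_add_polarLog u)).1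

/-- `u = exp(polarLog u)·polarUnit u`. [folklore] -/
theorem exp_polarLog_mul_polarUnit (u : 𝔸ˣ) : exp (polarLog u) * polarUnit u = u :=
  (exp_neg_mul_mem_unitary u.isUnit (isSelfAdjoint_polarLog u) (exp_polarLog_add_polarLog u)).2.symm

/-- Norm control of the logarithm: `‖u‖ < e^{α}` and `‖u⁻¹‖ < e^{α}` (`α > 0`) give `‖polarLog u‖ < α`
(spectrum of `u u⋆` inside `(e^{−2α}, e^{2α})`, isometric functional calculus). [folklore] -/
theorem norm_polarLog_lt {α : ℝ} (hα : 0 < α) (u : 𝔸ˣ) (h1 : ‖(u : 𝔸)‖ < Real.exp α)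
    (h2 : ‖((u⁻¹ : 𝔸ˣ) : 𝔸)‖ < Real.exp α) : ‖polarLog u‖ < α := by
  rcases subsingleton_or_nontrivial 𝔸 with h𝔸 | h𝔸
  · rw [Subsingleton.elim (polarLog u) 0, norm_zero]; exact hα
  have hP : ∀ x ∈ spectrum ℝ ((u : 𝔸) * star (u : 𝔸)), |Real.log x| < 2 * α := by
    intro x hx
    have hx0 : 0 < x := spectrum_mul_star_self_pos u x hx
    -- upper bound
    have hup : x < Real.exp (2 * α) := by
      have h := spectrum.norm_le_norm_of_mem hx
      rw [Real.norm_eq_abs, abs_of_pos hx0, CStarRing.norm_self_mul_star] at h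
      have : ‖(u : 𝔸)‖ * ‖(u : 𝔸)‖ < Real.exp α * Real.exp α :=
        mul_lt_mul'' h1 h1 (norm_nonneg _) (norm_nonneg _)
      rw [← Real.exp_add, ← two_mul] at this
      exact h.trans_lt this
    -- lower bound via the inverse
    have hlow : Real.exp (-(2 * α)) < x := by
      have hxU : ((Units.mk0 x hx0.ne' : ℝˣ) : ℝ) ∈ spectrum ℝ (((u * star u : 𝔸ˣ) : 𝔸)) := by
        rwa [Units.val_mk0, Units.val_mul, Units.coe_star]
      have hinv := spectrum.inv_mem_iff.mp hxU
      rw [Units.val_inv_eq_inv_val, Units.val_mk0, mul_inv_rev, Units.val_mul, Units.coe_star_inv] at hinv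
      have h := spectrum.norm_le_norm_of_mem hinv
      rw [Real.norm_eq_abs, abs_of_pos (inv_pos.2 hx0), CStarRing.norm_star_mul_self] at h
      have : ‖((u⁻¹ : 𝔸ˣ) : 𝔸)‖ * ‖((u⁻¹ : 𝔸ˣ) : 𝔸)‖ < Real.exp α * Real.exp α :=
        mul_lt_mul'' h2 h2 (norm_nonneg _) (norm_nonneg _)
      rw [← Real.exp_add, ← two_mul] at this
      have hxi : x⁻¹ < Real.exp (2 * α) := h.trans_lt this
      rw [Real.exp_neg]
      exact inv_lt_of_inv_lt₀ hx0 hxi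
    rw [abs_lt]
    constructor
    · have := Real.lt_log_iff_exp_lt hx0 |>.2 hlow
      linarith
    · exact (Real.log_lt_iff_lt_exp hx0).2 hup
  have hlog : ‖CFC.log ((u : 𝔸) * star (u : 𝔸))‖ < 2 * α := by
    rw [CFC.log]
    exact norm_cfc_lt (by linarith) fun x hx => by rw [Real.norm_eq_abs]; exact hP x hx
  calc ‖polarLog u‖ = (1 / 2 : ℝ) * ‖CFC.log ((u : 𝔸) * star (u : 𝔸))‖ := by
        rw [polarLog, norm_smul, Real.norm_of_nonneg (by norm_num)]
    _ < (1 / 2 : ℝ) * (2 * α) := by gcongr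
    _ = α := by ring

/-- **THE TUBE IS A NORM ANNULUS**: for `α > 0`, an invertible `u` lies in `Tube 𝔸 α = {exp(B)·U : ‖B‖ < α, U unitary}`
iff `‖u‖ < e^{α}` and `‖u⁻¹‖ < e^{α}`; and then `B` may be taken SELF-ADJOINT (`polarLog u`). [folklore] -/
theorem coe_mem_tube_iff {α : ℝ} (hα : 0 < α) (u : 𝔸ˣ) :
    (u : 𝔸) ∈ Tube 𝔸 α ↔ ‖(u : 𝔸)‖ < Real.exp α ∧ ‖((u⁻¹ : 𝔸ˣ) : 𝔸)‖ < Real.exp α := by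
  letI : NormedAlgebra ℚ 𝔸 := NormedAlgebra.restrictScalars ℚ ℂ 𝔸
  rcases subsingleton_or_nontrivial 𝔸 with h𝔸 | h𝔸
  · refine ⟨fun _ => ⟨?_, ?_⟩, fun _ => ⟨0, u, by rw [norm_zero]; exact hα, ?_, by rw [exp_zero, one_mul]⟩⟩
    · rw [Subsingleton.elim (u : 𝔸) 0, norm_zero]; exact Real.exp_pos α
    · rw [Subsingleton.elim ((u⁻¹ : 𝔸ˣ) : 𝔸) 0, norm_zero]; exact Real.exp_pos α
    · rw [Unitary.mem_iff]; constructor <;> exact Subsingleton.elim _ _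
  constructor
  · rintro ⟨B, U, hB, hU, hV⟩
    have hU1 : ‖U‖ = 1 := CStarRing.norm_of_mem_unitary hU
    have hexpB : ‖exp B‖ < Real.exp α :=
      (QuantumLattice.norm_exp_le ℂ B).trans_lt (Real.exp_lt_exp.2 hB)
    have hexpnB : ‖exp (-B)‖ < Real.exp α :=
      (QuantumLattice.norm_exp_le ℂ (-B)).trans_lt (by rw [norm_neg]; exact Real.exp_lt_exp.2 hB)
    have hc1 : exp B * exp (-B) = 1 := by
      rw [← exp_add_of_commute (Commute.refl B).neg_right, add_neg_cancel, exp_zero]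
    have hinv : ((u⁻¹ : 𝔸ˣ) : 𝔸) = star U * exp (-B) := by
      refine Units.inv_eq_of_mul_eq_one_right ?_
      rw [hV]
      calc exp B * U * (star U * exp (-B)) = exp B * (U * star U) * exp (-B) := by noncomm_ring
        _ = 1 := by rw [Unitary.mul_star_self_of_mem hU, mul_one, hc1]
    refine ⟨?_, ?_⟩
    · rw [hV]
      calc ‖exp B * U‖ ≤ ‖exp B‖ * ‖U‖ := norm_mul_le _ _
        _ < Real.exp α := by rw [hU1, mul_one]; exact hexpB
    · rw [hinv, CStarRing.norm_mem_unitary_mul _ (Unitary.star_mem hU)]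
      exact hexpnB
  · rintro ⟨h1, h2⟩
    exact ⟨polarLog u, polarUnit u, norm_polarLog_lt hα u h1 h2, polarUnit_mem_unitary u,
      (exp_polarLog_mul_polarUnit u).symm⟩

end Polar


/-! ## §3. The three-lines bound for `t ↦ exp(tB_x)·Q·exp(−tB_y)` (Hadamard / Heinz–Kato) -/

section ThreeLines

open Complex.HadamardThreeLines

variable {𝔸 : Type*} [CStarAlgebra 𝔸]

/-- The interpolating family `z ↦ exp(z·B_x)·Q·exp(−z·B_y)`, `z ∈ ℂ`. [folklore] -/
noncomputable def interp (Bx By Q : 𝔸) (z : ℂ) : 𝔸 := exp (z • Bx) * Q * exp (-(z • By))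

/-- It is entire. [folklore] -/
theorem differentiable_interp (Bx By Q : 𝔸) : Differentiable ℂ (interp Bx By Q) := by
  have hexp : Differentiable ℂ (exp : 𝔸 → 𝔸) := fun x => (exp_analytic (𝕂 := ℂ) x).differentiableAt
  show Differentiable ℂ fun z : ℂ => exp (z • Bx) * Q * exp (-(z • By))
  exact ((hexp.comp (differentiable_id.smul_const Bx)).mul_const Q).mul
    (hexp.comp (differentiable_id.smul_const By).neg)

/-- Splitting off the unitary factor: `exp(z·B) = exp(i·Im z·B)·exp(Re z·B)`. [folklore] -/
theorem exp_smul_eq_mul (B : 𝔸) (z : ℂ) :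
    exp (z • B) = exp (((z.im : ℂ) * Complex.I) • B) * exp ((z.re : ℂ) • B) := by
  letI : NormedAlgebra ℚ 𝔸 := NormedAlgebra.restrictScalars ℚ ℂ 𝔸
  have hsplit : z • B = ((z.im : ℂ) * Complex.I) • B + (z.re : ℂ) • B := by
    rw [← add_smul]
    congr 1
    rw [add_comm]
    exact (Complex.re_add_im z).symm
  rw [hsplit]
  exact exp_add_of_commute (((Commute.refl B).smul_left _).smul_right _)

/-- … and `exp(−z·B) = exp(−Re z·B)·exp(−i·Im z·B)`. [folklore] -/
theorem exp_neg_smul_eq_mul (B : 𝔸) (z : ℂ) :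
    exp (-(z • B)) = exp (-((z.re : ℂ) • B)) * exp (-(((z.im : ℂ) * Complex.I) • B)) := by
  letI : NormedAlgebra ℚ 𝔸 := NormedAlgebra.restrictScalars ℚ ℂ 𝔸
  have hsplit : -(z • B) = -((z.re : ℂ) • B) + -(((z.im : ℂ) * Complex.I) • B) := by
    rw [← neg_add, ← add_smul]
    congr 2
    exact (Complex.re_add_im z).symm
  rw [hsplit]
  exact exp_add_of_commute (((Commute.refl B).smul_left _).smul_right _).neg_left.neg_right

/-- `i·y·B` is skew-adjoint for `B` self-adjoint and `y` real. [folklore] -/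
theorem imag_smul_mem_skewAdjoint {B : 𝔸} (hB : IsSelfAdjoint B) (y : ℝ) :
    ((y : ℂ) * Complex.I) • B ∈ skewAdjoint 𝔸 := by
  rw [mul_smul]
  exact ofReal_smul_mem_skewAdjoint (I_smul_mem_skewAdjoint hB.star_eq) y

/-- Hence `exp(i·y·B)` is unitary … [folklore] -/
theorem exp_imag_smul_mem_unitary {B : 𝔸} (hB : IsSelfAdjoint B) (y : ℝ) :
    exp (((y : ℂ) * Complex.I) • B) ∈ unitary 𝔸 := by
  letI : NormedAlgebra ℚ 𝔸 := NormedAlgebra.restrictScalars ℚ ℂ 𝔸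
  exact exp_mem_unitary_of_mem_skewAdjoint (imag_smul_mem_skewAdjoint hB y)

/-- … and so is `exp(−i·y·B)`. [folklore] -/
theorem exp_neg_imag_smul_mem_unitary {B : 𝔸} (hB : IsSelfAdjoint B) (y : ℝ) :
    exp (-(((y : ℂ) * Complex.I) • B)) ∈ unitary 𝔸 := by
  letI : NormedAlgebra ℚ 𝔸 := NormedAlgebra.restrictScalars ℚ ℂ 𝔸
  exact exp_mem_unitary_of_mem_skewAdjoint ((skewAdjoint 𝔸).neg_mem (imag_smul_mem_skewAdjoint hB y))

/-- ON VERTICAL LINES THE NORM ONLY SEES THE REAL PART: `‖exp(zB_x) Q exp(−zB_y)‖ = ‖exp(Re z·B_x) Q exp(−Re z·B_y)‖`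
for self-adjoint `B_x, B_y` (the imaginary parts contribute unitary factors; C⋆-norm). [folklore] -/
theorem norm_interp_eq {Bx By : 𝔸} (hx : IsSelfAdjoint Bx) (hy : IsSelfAdjoint By) (Q : 𝔸) (z : ℂ) :
    ‖interp Bx By Q z‖ = ‖exp ((z.re : ℂ) • Bx) * Q * exp (-((z.re : ℂ) • By))‖ := by
  rw [interp, exp_smul_eq_mul Bx z, exp_neg_smul_eq_mul By z]
  have : exp (((z.im : ℂ) * Complex.I) • Bx) * exp ((z.re : ℂ) • Bx) * Q *
        (exp (-((z.re : ℂ) • By)) * exp (-(((z.im : ℂ) * Complex.I) • By))) =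
      exp (((z.im : ℂ) * Complex.I) • Bx) * (exp ((z.re : ℂ) • Bx) * Q * exp (-((z.re : ℂ) • By))) *
        exp (-(((z.im : ℂ) * Complex.I) • By)) := by
    simp only [mul_assoc]
  rw [this, CStarRing.norm_mul_mem_unitary _ (exp_neg_imag_smul_mem_unitary hy _),
    CStarRing.norm_mem_unitary_mul _ (exp_imag_smul_mem_unitary hx _)]

/-- **THREE-LINES BOUND (Hadamard; the Heinz–Kato mechanism).**  For self-adjoint `B_x, B_y`, any `Q` and
`t ∈ [0, 1]`: `‖exp(tB_x)·Q·exp(−tB_y)‖ ≤ ‖Q‖^{1−t}·‖exp(B_x)·Q·exp(−B_y)‖^{t}` — `z ↦ exp(zB_x)Q exp(−zB_y)` is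
entire, of norm `‖Q‖` on `Re z = 0` and `‖exp(B_x)Q exp(−B_y)‖` on `Re z = 1`, bounded on the strip (Mathlib's
`Complex.HadamardThreeLines.norm_le_interp_of_mem_verticalClosedStrip₀₁'`). [folklore] -/
theorem norm_exp_mul_mul_exp_neg_le_rpow {Bx By : 𝔸} (hx : IsSelfAdjoint Bx) (hy : IsSelfAdjoint By) (Q : 𝔸)
    {t : ℝ} (ht0 : 0 ≤ t) (ht1 : t ≤ 1) :
    ‖exp ((t : ℂ) • Bx) * Q * exp (-((t : ℂ) • By))‖ ≤
      ‖Q‖ ^ (1 - t) * ‖exp Bx * Q * exp (-By)‖ ^ t := by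
  have hz : (t : ℂ) ∈ verticalClosedStrip 0 1 := by
    simp only [verticalClosedStrip, mem_preimage, Complex.ofReal_re, mem_Icc]
    exact ⟨ht0, ht1⟩
  have hd : DiffContOnCl ℂ (interp Bx By Q) (verticalStrip 0 1) :=
    (differentiable_interp Bx By Q).diffContOnCl
  have hgc : Continuous fun s : ℝ => interp Bx By Q (s : ℂ) :=
    (differentiable_interp Bx By Q).continuous.comp Complex.continuous_ofReal
  obtain ⟨C, hC⟩ := (isCompact_Icc (a := (0 : ℝ)) (b := 1)).exists_bound_of_continuousOn hgc.continuousOn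
  have hB : BddAbove ((norm ∘ interp Bx By Q) '' verticalClosedStrip 0 1) := by
    refine ⟨C, ?_⟩
    rintro _ ⟨z, hz', rfl⟩
    have h1 : ‖interp Bx By Q z‖ = ‖interp Bx By Q (z.re : ℂ)‖ := by
      rw [norm_interp_eq hx hy Q z, norm_interp_eq hx hy Q (z.re : ℂ), Complex.ofReal_re]
    simp only [Function.comp_apply]
    rw [h1]
    exact hC z.re hz'
  have ha : ∀ z ∈ Complex.re ⁻¹' {(0 : ℝ)}, ‖interp Bx By Q z‖ ≤ ‖Q‖ := by
    intro z hz'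
    have hz0 : z.re = 0 := hz'
    rw [norm_interp_eq hx hy Q z, hz0, Complex.ofReal_zero, zero_smul, zero_smul, neg_zero, exp_zero, one_mul,
      mul_one]
  have hb : ∀ z ∈ Complex.re ⁻¹' {(1 : ℝ)}, ‖interp Bx By Q z‖ ≤ ‖exp Bx * Q * exp (-By)‖ := by
    intro z hz'
    have hz1 : z.re = 1 := hz'
    rw [norm_interp_eq hx hy Q z, hz1, Complex.ofReal_one, one_smul, one_smul]
  have h := norm_le_interp_of_mem_verticalClosedStrip₀₁' (interp Bx By Q) hz hd hB ha hb
  rw [Complex.ofReal_re] at h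
  exact h

/-- Weighted geometric means are dominated by the maximum: `a^{1−t} b^{t} ≤ max a b` (`a, b ≥ 0`, `t ∈ [0,1]`).
[folklore] -/
theorem rpow_mul_rpow_le_max {a b t : ℝ} (ha : 0 ≤ a) (hb : 0 ≤ b) (ht0 : 0 ≤ t) (ht1 : t ≤ 1) :
    a ^ (1 - t) * b ^ t ≤ max a b := by
  have hm : 0 ≤ max a b := le_max_of_le_left ha
  calc a ^ (1 - t) * b ^ t ≤ (max a b) ^ (1 - t) * (max a b) ^ t :=
        mul_le_mul (Real.rpow_le_rpow ha (le_max_left a b) (by linarith))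
          (Real.rpow_le_rpow hb (le_max_right a b) ht0) (Real.rpow_nonneg hb _) (Real.rpow_nonneg hm _)
    _ = max a b := by
        rw [← Real.rpow_add' hm (by norm_num : (1 - t) + t ≠ 0)]
        norm_num

/-- **THE FORM USED BY THE CHAIN**: `‖exp(tB_x)·Q·exp(−tB_y)‖ ≤ max(‖Q‖, ‖exp(B_x)·Q·exp(−B_y)‖)` for `t ∈ [0,1]` — a
bi-covariant norm condition satisfied at both ends of a polar path is satisfied all along it. [folklore] -/
theorem norm_exp_mul_mul_exp_neg_le_max {Bx By : 𝔸} (hx : IsSelfAdjoint Bx) (hy : IsSelfAdjoint By) (Q : 𝔸)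
    {t : ℝ} (ht0 : 0 ≤ t) (ht1 : t ≤ 1) :
    ‖exp ((t : ℂ) • Bx) * Q * exp (-((t : ℂ) • By))‖ ≤ max ‖Q‖ ‖exp Bx * Q * exp (-By)‖ :=
  (norm_exp_mul_mul_exp_neg_le_rpow hx hy Q ht0 ht1).trans
    (rpow_mul_rpow_le_max (norm_nonneg _) (norm_nonneg _) ht0 ht1)

end ThreeLines


/-! ## §4. Polar paths, polar-convex condition sets, and the tube chain -/

section PolarPath

variable {𝔸 : Type*} [CStarAlgebra 𝔸]

/-- `exp B` as a unit is the tree's `B7Prop1Explicit.expUnit B` (value `exp B`, inverse `exp(−B)`); the value of the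
inverse, read in `𝔸`. [folklore] -/
theorem coe_inv_expUnit (B : 𝔸) : (((expUnit B)⁻¹ : 𝔸ˣ) : 𝔸) = exp (-B) := rfl

/-- The unitary part `polarUnit u` as a unit, with inverse its adjoint. [folklore] -/
noncomputable def polarUnitU (u : 𝔸ˣ) : 𝔸ˣ :=
  ⟨polarUnit u, star (polarUnit u), Unitary.mul_star_self_of_mem (polarUnit_mem_unitary u),
    Unitary.star_mul_self_of_mem (polarUnit_mem_unitary u)⟩

/-- Value of `polarUnitU`. [folklore] -/
@[simp] theorem val_polarUnitU (u : 𝔸ˣ) : (polarUnitU u : 𝔸) = polarUnit u := rfl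

/-- Inverse of `polarUnitU` = adjoint. [folklore] -/
@[simp] theorem val_inv_polarUnitU (u : 𝔸ˣ) : ((polarUnitU u)⁻¹ : 𝔸ˣ) = star (polarUnit u) := rfl

/-- THE POLAR PATH of a single invertible element: `t ↦ exp(t·polarLog u)·polarUnit u` (a unit for every real `t`;
`t = 0`: the unitary part, `t = 1`: `u` itself). [folklore] -/
noncomputable def polarStep (u : 𝔸ˣ) (t : ℝ) : 𝔸ˣ := expUnit ((t : ℂ) • polarLog u) * polarUnitU u

/-- Value of `polarStep`. [folklore] -/
theorem val_polarStep (u : 𝔸ˣ) (t : ℝ) :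
    (polarStep u t : 𝔸) = exp ((t : ℂ) • polarLog u) * polarUnit u := rfl

/-- Inverse of `polarStep`: `polarUnit(u)⋆·exp(−t·polarLog u)`. [folklore] -/
theorem val_inv_polarStep (u : 𝔸ˣ) (t : ℝ) :
    ((polarStep u t)⁻¹ : 𝔸ˣ) = star (polarUnit u) * exp (-((t : ℂ) • polarLog u)) := by
  rw [polarStep, mul_inv_rev, Units.val_mul, val_inv_polarUnitU, coe_inv_expUnit]

/-- End of the path: `polarStep u 1 = u`. [folklore] -/
theorem polarStep_one (u : 𝔸ˣ) : polarStep u 1 = u :=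
  Units.ext (by rw [val_polarStep, Complex.ofReal_one, one_smul, exp_polarLog_mul_polarUnit])

/-- Start of the path: the unitary part. [folklore] -/
theorem val_polarStep_zero (u : 𝔸ˣ) : (polarStep u 0 : 𝔸) = polarUnit u := by
  rw [val_polarStep, Complex.ofReal_zero, zero_smul, exp_zero, one_mul]

/-- Additivity in the parameter: `polarStep u (s + t) = exp(s·polarLog u) · polarStep u t`. [folklore] -/
theorem polarStep_add (u : 𝔸ˣ) (s t : ℝ) :
    polarStep u (s + t) = expUnit ((s : ℂ) • polarLog u) * polarStep u t := by
  letI : NormedAlgebra ℚ 𝔸 := NormedAlgebra.restrictScalars ℚ ℂ 𝔸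
  refine Units.ext ?_
  rw [Units.val_mul, val_polarStep, val_polarStep, val_expUnit, ← mul_assoc, Complex.ofReal_add, add_smul,
    exp_add_of_commute (((Commute.refl (polarLog u)).smul_left _).smul_right _)]

/-- **RIGIDITY OF THE POLAR FORM ON THE UNITARY SLICE.**  If `exp(B_x)·W·exp(−B_y)` is unitary, for self-adjoint
`B_x, B_y` and unitary `W`, then it EQUALS `W` (comparing `X⁻¹` with `X⋆` gives `exp(2B_x) = W exp(2B_y) W⋆`, the
self-adjoint logarithm gives `B_x = W B_y W⋆`). [folklore] -/
theorem exp_mul_mul_exp_neg_eq_of_mem_unitary {Bx By W : 𝔸} (hx : IsSelfAdjoint Bx) (hy : IsSelfAdjoint By)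
    (hW : W ∈ unitary 𝔸) (h : exp Bx * W * exp (-By) ∈ unitary 𝔸) : exp Bx * W * exp (-By) = W := by
  letI : NormedAlgebra ℚ 𝔸 := NormedAlgebra.restrictScalars ℚ ℂ 𝔸
  set Wu : 𝔸ˣ := ⟨W, star W, Unitary.mul_star_self_of_mem hW, Unitary.star_mul_self_of_mem hW⟩ with hWu
  have hWval : (Wu : 𝔸) = W := rfl
  have hWinv : ((Wu⁻¹ : 𝔸ˣ) : 𝔸) = star W := rfl
  set a : 𝔸ˣ := expUnit By with ha
  set b : 𝔸ˣ := expUnit Bx with hb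
  set Xu : 𝔸ˣ := b * Wu * a⁻¹ with hXu
  have hXval : (Xu : 𝔸) = exp Bx * W * exp (-By) := by
    rw [hXu, Units.val_mul, Units.val_mul, hb, val_expUnit, hWval, ha, coe_inv_expUnit]
  have hXinv : ((Xu⁻¹ : 𝔸ˣ) : 𝔸) = star (Xu : 𝔸) := by
    refine Units.inv_eq_of_mul_eq_one_right ?_
    rw [hXval]
    exact Unitary.mul_star_self_of_mem h
  -- `X⁻¹ = X⋆` read in the group of units: `a W⁻¹ b⁻¹ = a⁻¹ W⁻¹ b`
  have hunits : Xu⁻¹ = a⁻¹ * Wu⁻¹ * b := by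
    refine Units.ext ?_
    rw [hXinv, hXval, star_mul, star_mul, hx.exp.star_eq, hy.neg.exp.star_eq, Units.val_mul, Units.val_mul, ha,
      coe_inv_expUnit, hWinv, hb, val_expUnit, mul_assoc]
  have key : b * b = Wu * (a * a) * Wu⁻¹ := by
    have h' : a * Wu⁻¹ * b⁻¹ = a⁻¹ * Wu⁻¹ * b := by rw [← hunits, hXu]; group
    calc b * b = (b * (a * Wu⁻¹ * b⁻¹)⁻¹) * (a * Wu⁻¹) := by group
      _ = (b * (a⁻¹ * Wu⁻¹ * b)⁻¹) * (a * Wu⁻¹) := by rw [h']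
      _ = Wu * (a * a) * Wu⁻¹ := by group
  -- back in `𝔸`: `exp(2B_x) = W exp(2B_y) W⋆ = exp(W 2B_y W⋆)`, then take the self-adjoint logarithm
  have hval : exp (Bx + Bx) = exp (W * (By + By) * star W) := by
    have h1 := congrArg Units.val key
    rw [Units.val_mul, Units.val_mul, Units.val_mul, Units.val_mul, hb, val_expUnit, ha, val_expUnit, hWval, hWinv,
      ← exp_add_of_commute (Commute.refl Bx), ← exp_add_of_commute (Commute.refl By)] at h1
    rw [h1]
    have h2 := exp_units_conj Wu (By + By)
    rw [hWval, hWinv] at h2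
    exact h2.symm
  have hlog := congrArg CFC.log hval
  rw [CFC.log_exp (Bx + Bx) (hx.add hx), CFC.log_exp _ ((hy.add hy).conjugate W)] at hlog
  have hB : Bx = W * By * star W := by
    have h2 : (2 : ℝ) • Bx = (2 : ℝ) • (W * By * star W) := by
      rw [two_smul, two_smul, hlog, mul_add, add_mul]
    exact smul_right_injective 𝔸 two_ne_zero h2
  have hexpBx : exp Bx * W = W * exp By := by
    have h2 := exp_units_conj Wu By
    rw [hWval, hWinv] at h2
    rw [hB, h2, mul_assoc, Unitary.star_mul_self_of_mem hW, mul_one]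
  rw [hexpBx, mul_assoc, ← exp_add_of_commute (Commute.refl By).neg_right, add_neg_cancel, exp_zero, mul_one]

end PolarPath

section Chain

variable {ι S : Type*} {𝔸 : Type*} [CStarAlgebra 𝔸] (γ : Ends ι S)

/-- THE POLAR PATH of a `Gᶜ`-valued gauge transformation `g : S → 𝔸ˣ`, sitewise: `polarPath g t x = polarStep (g x) t`.
[folklore] -/
noncomputable def polarPath (g : S → 𝔸ˣ) (t : ℝ) : S → 𝔸ˣ := fun x => polarStep (g x) t

/-- `polarPath g 1 = g`. [folklore] -/
theorem polarPath_one (g : S → 𝔸ˣ) : polarPath g 1 = g := funext fun x => polarStep_one (g x)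

/-- Additivity: `polarPath g (s + t) = (x ↦ exp(s·polarLog(g x))) * polarPath g t`. [folklore] -/
theorem polarPath_add (g : S → 𝔸ˣ) (s t : ℝ) :
    polarPath g (s + t) = (fun x => expUnit ((s : ℂ) • polarLog (g x))) * polarPath g t :=
  funext fun x => polarStep_add (g x) s t

/-- The unitary start `polarPath g 0` is tube-valued for every `a > 0`. [folklore] -/
theorem polarPath_zero_mem_tubeCfg (g : S → 𝔸ˣ) {a : ℝ} (ha : 0 < a) :
    (fun x => (polarPath g 0 x : 𝔸)) ∈ TubeCfg S 𝔸 a :=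
  mem_tubeCfg_of_unitary ha fun x => by
    show (polarStep (g x) 0 : 𝔸) ∈ unitary 𝔸
    rw [val_polarStep_zero]; exact polarUnit_mem_unitary (g x)

/-- A short axial step `x ↦ exp(s·polarLog (g x))` is tube-valued once `|s|·‖polarLog (g x)‖ < a` for all `x`. [folklore] -/
theorem expUnit_smul_polarLog_mem_tubeCfg (g : S → 𝔸ˣ) {s a : ℝ} (h : ∀ x, |s| * ‖polarLog (g x)‖ < a) :
    (fun x => (expUnit ((s : ℂ) • polarLog (g x)) : 𝔸)) ∈ TubeCfg S 𝔸 a := by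
  refine mem_tubeCfg.2 fun x => ?_
  rw [val_expUnit, ← mul_one (exp ((s : ℂ) • polarLog (g x)))]
  refine exp_mul_mem_tube ?_ (one_mem _)
  rw [norm_smul, Complex.norm_real, Real.norm_eq_abs]
  exact h x

/-- **BI-COVARIANCE.**  A quantity `Q : (ι → 𝔸) → 𝔸` is BI-COVARIANT with charge `(x, y) ∈ S × S` if
`Q(g • V) = g(x)·Q(V)·g(y)⁻¹` for every `Gᶜ`-valued gauge transformation `g` — e.g. a bond variable `V_b`
(charge `(b₋, b₊)`), its inverse (charge `(b₊, b₋)`), a plaquette holonomy `∂V(p)` and `∂V(p) − 1` (charge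
`(x_p, x_p)`), an algebra-valued field `J_b ↦ R(u(b₋))J_b` modelled as a loop index (charge `(b₋, b₋)`).
[cite: Balaban1987RG1, p.262 (1.10)] for the action; the notion is folklore. -/
def BiCov (Q : (ι → 𝔸) → 𝔸) (x y : S) : Prop :=
  ∀ (g : S → 𝔸ˣ) (V : Cfg γ 𝔸), Q (g • V) = (g x : 𝔸) * Q V * ((g y)⁻¹ : 𝔸ˣ)

variable {γ}

/-- The action bondwise: `(g • V)_b = g(b₋)·V_b·g(b₊)⁻¹` ([I] (1.10) / [13] (3.28)). [cite: Balaban1987RG1, p.262 (1.10)] -/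
theorem smul_apply (g : S → 𝔸ˣ) (V : Cfg γ 𝔸) (b : ι) :
    (g • V) b = (g (γ.src b) : 𝔸) * V b * ((g (γ.tgt b))⁻¹ : 𝔸ˣ) := rfl

/-- Bond variables are bi-covariant. [folklore] -/
theorem biCov_apply (b : ι) : BiCov γ (fun V : ι → 𝔸 => V b) (γ.src b) (γ.tgt b) := fun _ _ => rfl

/-- Inverses of bond variables are bi-covariant (with the junk value `Ring.inverse = 0` off units). [folklore] -/
theorem biCov_inverse (b : ι) : BiCov γ (fun V : ι → 𝔸 => Ring.inverse (V b)) (γ.tgt b) (γ.src b) := by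
  intro g V
  simp only [smul_apply]
  by_cases hu : IsUnit (V b)
  · obtain ⟨w, hw⟩ := hu
    rw [← hw, ← Units.val_mul, ← Units.val_mul, Ring.inverse_unit, Ring.inverse_unit, mul_inv_rev, mul_inv_rev,
      inv_inv, Units.val_mul, Units.val_mul, mul_assoc]
  · have hu' : ¬ IsUnit ((g (γ.src b) : 𝔸) * V b * ((g (γ.tgt b))⁻¹ : 𝔸ˣ)) := by
      intro h
      apply hu
      have h2 : IsUnit (((g (γ.src b))⁻¹ : 𝔸ˣ) * ((g (γ.src b) : 𝔸) * V b * ((g (γ.tgt b))⁻¹ : 𝔸ˣ)) *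
          (g (γ.tgt b) : 𝔸)) := ((Units.isUnit _).mul h).mul (Units.isUnit _)
      have h3 : ((g (γ.src b))⁻¹ : 𝔸ˣ) * ((g (γ.src b) : 𝔸) * V b * ((g (γ.tgt b))⁻¹ : 𝔸ˣ)) *
          (g (γ.tgt b) : 𝔸) = V b := by
        rw [← mul_assoc, ← mul_assoc, Units.inv_mul, one_mul, mul_assoc, Units.inv_mul, mul_one]
      rwa [h3] at h2
    rw [Ring.inverse_non_unit _ hu, Ring.inverse_non_unit _ hu', mul_zero, zero_mul]

/-- Products of bi-covariant quantities with matching charges are bi-covariant. [folklore] -/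
theorem BiCov.mul {Q₁ Q₂ : (ι → 𝔸) → 𝔸} {x y z : S} (h₁ : BiCov γ Q₁ x y) (h₂ : BiCov γ Q₂ y z) :
    BiCov γ (fun V => Q₁ V * Q₂ V) x z := by
  intro g V
  show Q₁ (g • V) * Q₂ (g • V) = (g x : 𝔸) * (Q₁ V * Q₂ V) * ((g z)⁻¹ : 𝔸ˣ)
  rw [h₁ g V, h₂ g V]
  simp only [mul_assoc, Units.inv_mul_cancel_left]

/-- `Q − 1` is bi-covariant when `Q` has a diagonal charge `(x, x)` (e.g. `∂V(p) − 1`). [folklore] -/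
theorem BiCov.sub_one {Q : (ι → 𝔸) → 𝔸} {x : S} (h : BiCov γ Q x x) : BiCov γ (fun V => Q V - 1) x x := by
  intro g V
  simp only [h g V, mul_sub, sub_mul, mul_one, Units.mul_inv]

/-- Along the polar path a bi-covariant quantity is conjugated exactly as in §3:
`Q(polarPath g t • V) = exp(t·B_x)·(v_x·Q(V)·v_y⋆)·exp(−t·B_y)`. [folklore] -/
theorem biCov_polarPath {Q : (ι → 𝔸) → 𝔸} {x y : S} (hQ : BiCov γ Q x y) (g : S → 𝔸ˣ) (V : Cfg γ 𝔸) (t : ℝ) :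
    Q (polarPath g t • V) = exp ((t : ℂ) • polarLog (g x)) * (polarUnit (g x) * Q V * star (polarUnit (g y))) *
      exp (-((t : ℂ) • polarLog (g y))) := by
  rw [hQ (polarPath g t) V]
  simp only [polarPath, val_polarStep, val_inv_polarStep, mul_assoc]

/-- **NORM CONTROL ALONG THE POLAR PATH.**  For a bi-covariant `Q` and `t ∈ [0,1]`:
`‖Q(polarPath g t • V)‖ ≤ max(‖Q V‖, ‖Q(g • V)‖)`. [folklore] -/
theorem norm_biCov_polarPath_le {Q : (ι → 𝔸) → 𝔸} {x y : S} (hQ : BiCov γ Q x y) (g : S → 𝔸ˣ) (V : Cfg γ 𝔸)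
    {t : ℝ} (ht0 : 0 ≤ t) (ht1 : t ≤ 1) : ‖Q (polarPath g t • V)‖ ≤ max ‖Q V‖ ‖Q (g • V)‖ := by
  have h1 := biCov_polarPath hQ g V 1
  rw [polarPath_one, Complex.ofReal_one, one_smul, one_smul] at h1
  have hQ' : ‖polarUnit (g x) * Q V * star (polarUnit (g y))‖ = ‖Q V‖ := by
    rw [CStarRing.norm_mul_mem_unitary _ (Unitary.star_mem (polarUnit_mem_unitary (g y))),
      CStarRing.norm_mem_unitary_mul _ (polarUnit_mem_unitary (g x))]
  rw [biCov_polarPath hQ g V t, ← hQ', h1]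
  exact norm_exp_mul_mul_exp_neg_le_max (isSelfAdjoint_polarLog (g x)) (isSelfAdjoint_polarLog (g y)) _ ht0 ht1

/-- **THE `G`-VALUED SLICE — orbit-constancy there is just (R1).**  If `V` and `g • V` are both unitary-valued
(`g : S → 𝔸ˣ` ARBITRARY), then `g • V = polarPath g 0 • V`: the unitary parts of `g` already do the job (rigidity
of the polar form, bond by bond). [folklore] -/
theorem smul_eq_polarPath_zero_smul (g : S → 𝔸ˣ) (V : Cfg γ 𝔸) (hV : ∀ b, V b ∈ unitary 𝔸)
    (hgV : ∀ b, (g • V) b ∈ unitary 𝔸) : g • V = polarPath g 0 • V := by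
  funext b
  have h1 := biCov_polarPath (biCov_apply (γ := γ) b) g V 1
  have h0 := biCov_polarPath (biCov_apply (γ := γ) b) g V 0
  rw [polarPath_one, Complex.ofReal_one, one_smul, one_smul] at h1
  rw [Complex.ofReal_zero, zero_smul, zero_smul, neg_zero, exp_zero, one_mul, mul_one] at h0
  have hW : polarUnit (g (γ.src b)) * V b * star (polarUnit (g (γ.tgt b))) ∈ unitary 𝔸 :=
    mul_mem (mul_mem (polarUnit_mem_unitary _) (hV b)) (Unitary.star_mem (polarUnit_mem_unitary _))
  rw [h0, h1]
  exact exp_mul_mul_exp_neg_eq_of_mem_unitary (isSelfAdjoint_polarLog _) (isSelfAdjoint_polarLog _) hW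
    (h1 ▸ hgV b)

/-- Hence on a set of UNITARY-VALUED configurations (the `U`-factor of [I] p. 262 (i) «U has values in the group G»)
(R3) follows from (R1) alone — no analyticity, no connectedness. [folklore] -/
theorem orbitConstOn_of_gInvariant_unitarySlice {F : (ι → 𝔸) → ℂ} {𝒮 : Set (ι → 𝔸)}
    (h𝒮 : ∀ V ∈ 𝒮, ∀ b, V b ∈ unitary 𝔸)
    (hG : ∀ V ∈ 𝒮, ∀ u : S → 𝔸, (∀ x, u x ∈ unitary 𝔸) → F (gaugeAct γ u V) = F V) : OrbitConstOn γ F 𝒮 := by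
  intro g V hV hgV
  rw [smul_eq_polarPath_zero_smul g V (h𝒮 V hV) (h𝒮 _ hgV), smul_eq_gaugeAct]
  refine hG V hV _ fun x => ?_
  show (polarStep (g x) 0 : 𝔸) ∈ unitary 𝔸
  rw [val_polarStep_zero]
  exact polarUnit_mem_unitary (g x)

variable (γ)

/-- **POLAR-CONVEX CONDITION SETS.**  `𝒞` is POLAR-CONVEX if whenever `V` and `g • V` (`g : S → 𝔸ˣ` arbitrary) lie in `𝒞`,
the whole polar path `polarPath g t • V`, `t ∈ [0,1]`, lies in `𝒞`. [folklore] -/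
def PolarConvex (𝒞 : Set (ι → 𝔸)) : Prop :=
  ∀ (g : S → 𝔸ˣ) (V : Cfg γ 𝔸), V ∈ 𝒞 → g • V ∈ 𝒞 → ∀ t : ℝ, 0 ≤ t → t ≤ 1 → polarPath g t • V ∈ 𝒞

variable {γ}

/-- Intersections of polar-convex sets are polar-convex. [folklore] -/
theorem PolarConvex.inter {𝒞₁ 𝒞₂ : Set (ι → 𝔸)} (h₁ : PolarConvex γ 𝒞₁) (h₂ : PolarConvex γ 𝒞₂) :
    PolarConvex γ (𝒞₁ ∩ 𝒞₂) :=
  fun g V hV hgV t ht0 ht1 => ⟨h₁ g V hV.1 hgV.1 t ht0 ht1, h₂ g V hV.2 hgV.2 t ht0 ht1⟩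

/-- Arbitrary intersections too. [folklore] -/
theorem polarConvex_iInter {K : Sort*} {𝒞 : K → Set (ι → 𝔸)} (h : ∀ k, PolarConvex γ (𝒞 k)) :
    PolarConvex γ (⋂ k, 𝒞 k) :=
  fun g V hV hgV t ht0 ht1 => mem_iInter.2 fun k => h k g V (mem_iInter.1 hV k) (mem_iInter.1 hgV k) t ht0 ht1

/-- `Gᶜ`-invariant sets are polar-convex. [folklore] -/
theorem polarConvex_of_invariant {𝒯 : Set (ι → 𝔸)} (h𝒯 : ∀ (g : S → 𝔸ˣ) (V : Cfg γ 𝔸), V ∈ 𝒯 → g • V ∈ 𝒯) :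
    PolarConvex γ 𝒯 :=
  fun g V hV _ t _ _ => h𝒯 (polarPath g t) V hV

/-- **Strict norm sublevel sets of bi-covariant quantities are polar-convex** (three lines). [folklore] -/
theorem polarConvex_normLt {Q : (ι → 𝔸) → 𝔸} {x y : S} (hQ : BiCov γ Q x y) (c : ℝ) :
    PolarConvex γ {V | ‖Q V‖ < c} :=
  fun g V hV hgV _ ht0 ht1 => (norm_biCov_polarPath_le hQ g V ht0 ht1).trans_lt (max_lt hV hgV)

/-- Non-strict ones as well. [folklore] -/
theorem polarConvex_normLe {Q : (ι → 𝔸) → 𝔸} {x y : S} (hQ : BiCov γ Q x y) (c : ℝ) :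
    PolarConvex γ {V | ‖Q V‖ ≤ c} :=
  fun g V hV hgV _ ht0 ht1 => (norm_biCov_polarPath_le hQ g V ht0 ht1).trans (max_le hV hgV)

/-- The set of configurations with invertible values is `Gᶜ`-invariant. [folklore] -/
theorem smul_mem_isUnit (g : S → 𝔸ˣ) (V : Cfg γ 𝔸) (hV : V ∈ {V : ι → 𝔸 | ∀ b, IsUnit (V b)}) :
    g • V ∈ {V : ι → 𝔸 | ∀ b, IsUnit (V b)} :=
  fun b => ((Units.isUnit _).mul (hV b)).mul (Units.isUnit _)

/-- **TUBE CONDITIONS ARE POLAR-CONVEX**: `{V : V_b ∈ Tube 𝔸 α}` (the lineage's model of `U′ = exp iξA′, |A′| < α₁` in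
(1.13), one bond at a time) — by §2 it is the `Gᶜ`-invariant set `{V_b invertible}` cut by the bi-covariant norm
conditions `‖V_b‖ < e^{α}`, `‖V_b⁻¹‖ < e^{α}`. [folklore] -/
theorem polarConvex_tubeAt (b : ι) (α : ℝ) : PolarConvex γ {V : ι → 𝔸 | V b ∈ Tube 𝔸 α} := by
  intro g V hVb hgVb t ht0 ht1
  change V b ∈ Tube 𝔸 α at hVb
  change (g • V) b ∈ Tube 𝔸 α at hgVb
  change (polarPath g t • V) b ∈ Tube 𝔸 α
  have hα : 0 < α := by
    obtain ⟨B, U, hB, -, -⟩ := hVb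
    exact (norm_nonneg B).trans_lt hB
  obtain ⟨w, hw⟩ := isUnit_of_mem_tube hVb
  -- the three units: `V b`, `(g • V) b`, `(polarPath g t • V) b`
  have hunit : ∀ h : S → 𝔸ˣ, (h • V) b = ((h (γ.src b) * w * (h (γ.tgt b))⁻¹ : 𝔸ˣ) : 𝔸) := by
    intro h; rw [smul_apply, ← hw, Units.val_mul, Units.val_mul]
  have hw1 := (coe_mem_tube_iff hα w).1 (hw ▸ hVb)
  have hg1 := (coe_mem_tube_iff hα _).1 ((hunit g) ▸ hgVb)
  rw [hunit (polarPath g t), coe_mem_tube_iff hα]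
  constructor
  · have := norm_biCov_polarPath_le (biCov_apply (γ := γ) b) g V ht0 ht1
    rw [hunit (polarPath g t)] at this
    refine this.trans_lt (max_lt ?_ ?_)
    · rw [← hw]; exact hw1.1
    · rw [hunit g]; exact hg1.1
  · have := norm_biCov_polarPath_le (biCov_inverse (γ := γ) b) g V ht0 ht1
    rw [hunit (polarPath g t), Ring.inverse_unit] at this
    refine this.trans_lt (max_lt ?_ ?_)
    · rw [← hw, Ring.inverse_unit]; exact hw1.2
    · rw [hunit g, Ring.inverse_unit]; exact hg1.2

/-- Hence tube conditions on any set of bonds are polar-convex … [folklore] -/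
theorem polarConvex_tubeOn (I : Set ι) (α : ℝ) : PolarConvex γ {V : ι → 𝔸 | ∀ b ∈ I, V b ∈ Tube 𝔸 α} := by
  have : {V : ι → 𝔸 | ∀ b ∈ I, V b ∈ Tube 𝔸 α} = ⋂ b ∈ I, {V : ι → 𝔸 | V b ∈ Tube 𝔸 α} := by
    ext V; simp only [mem_setOf_eq, mem_iInter]
  rw [this]
  exact polarConvex_iInter fun b => polarConvex_iInter fun _ => polarConvex_tubeAt b α

/-- … in particular the lineage's tube configuration space `TubeCfg ι 𝔸 α`. [folklore] -/
theorem polarConvex_tubeCfg (α : ℝ) : PolarConvex γ (TubeCfg ι 𝔸 α) := by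
  have : TubeCfg ι 𝔸 α = ⋂ b, {V : ι → 𝔸 | V b ∈ Tube 𝔸 α} := by
    ext V; simp only [mem_tubeCfg, mem_setOf_eq, mem_iInter]
  rw [this]
  exact polarConvex_iInter fun b => polarConvex_tubeAt b α

/-- **THE POLAR CHAIN.**  Every polar-convex set is tube-chain-connected (`B13Inv214Orbit.TubeChainConnected`) for
every tube half-width `a > 0`: from `V` one first applies the unitary part `polarPath g 0` of `g` (tube-valued), then
`N` equal axial steps `exp(polarLog(g x)/N)` with `N·a > max_x ‖polarLog (g x)‖` (each tube-valued), arriving at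
`polarPath g 1 • V = g • V`; all intermediate configurations `polarPath g (j/N) • V` lie in the set by polar convexity.
[folklore] mechanism; this is the «orbit» continuation input of [II] p.22 «This means» for condition sets of the shape
of [I] p.262 (iii) and the tube clause of (ii). -/
theorem tubeChainConnected_of_polarConvex [Fintype S] {a : ℝ} (ha : 0 < a) {𝒞 : Set (ι → 𝔸)}
    (h𝒞 : PolarConvex γ 𝒞) : TubeChainConnected γ a 𝒞 := by
  intro g V hV hgV
  -- number of axial steps
  set M : ℝ := ∑ x, ‖polarLog (g x)‖ with hM
  have hMx : ∀ x, ‖polarLog (g x)‖ ≤ M := fun x =>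
    Finset.single_le_sum (f := fun x => ‖polarLog (g x)‖) (fun _ _ => norm_nonneg _) (Finset.mem_univ x)
  have hM0 : 0 ≤ M := Finset.sum_nonneg fun _ _ => norm_nonneg _
  set N : ℕ := ⌊M / a⌋₊ + 1 with hN
  have hN0 : (0 : ℝ) < N := by positivity
  have hNa : M < N * a := by
    have := Nat.lt_floor_add_one (M / a)
    rw [hN, Nat.cast_add, Nat.cast_one]
    rwa [div_lt_iff₀ ha] at this
  have hstep : (fun x => (expUnit (((1 / (N : ℝ) : ℝ) : ℂ) • polarLog (g x)) : 𝔸)) ∈ TubeCfg S 𝔸 a := by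
    refine expUnit_smul_polarLog_mem_tubeCfg g fun x => ?_
    rw [abs_of_pos (by positivity), one_div, inv_mul_lt_iff₀ hN0]
    exact (hMx x).trans_lt hNa
  -- the chain, by induction on the number of axial steps taken
  have hchain : ∀ j : ℕ, j ≤ N → TubeReach γ a 𝒞 V (polarPath g ((j : ℝ) / N) • V) := by
    intro j
    induction j with
    | zero =>
      intro _
      rw [Nat.cast_zero, zero_div]
      exact TubeReach.step V V (polarPath g 0) (TubeReach.refl V hV) (polarPath_zero_mem_tubeCfg g ha)
        (h𝒞 g V hV hgV 0 le_rfl zero_le_one)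
    | succ j ih =>
      intro hj
      have hj' : j ≤ N := Nat.le_of_succ_le hj
      have hsplit : ((j + 1 : ℕ) : ℝ) / N = 1 / N + (j : ℝ) / N := by
        rw [Nat.cast_add, Nat.cast_one]; ring
      have ht1 : ((j + 1 : ℕ) : ℝ) / N ≤ 1 := by
        rw [div_le_one hN0]; exact_mod_cast hj
      have hmem := h𝒞 g V hV hgV (((j + 1 : ℕ) : ℝ) / N) (by positivity) ht1
      rw [hsplit] at hmem ⊢
      rw [polarPath_add, mul_smul] at hmem ⊢
      exact TubeReach.step V _ _ (ih hj') hstep hmem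
  have hend := hchain N le_rfl
  rwa [div_self hN0.ne', polarPath_one] at hend

/-- THE SHAPE OF [I] p.262 (iii)/(ii, tube clause): a `Gᶜ`-invariant set cut by finitely or infinitely many strict
bi-covariant norm conditions is tube-chain-connected. [folklore] -/
theorem tubeChainConnected_condSet [Fintype S] {a : ℝ} (ha : 0 < a) {K : Sort*} {𝒯 : Set (ι → 𝔸)}
    (h𝒯 : ∀ (g : S → 𝔸ˣ) (V : Cfg γ 𝔸), V ∈ 𝒯 → g • V ∈ 𝒯) {Q : K → (ι → 𝔸) → 𝔸} {x y : K → S}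
    (hQ : ∀ k, BiCov γ (Q k) (x k) (y k)) (c : K → ℝ) :
    TubeChainConnected γ a (𝒯 ∩ {V | ∀ k, ‖Q k V‖ < c k}) := by
  refine tubeChainConnected_of_polarConvex ha ((polarConvex_of_invariant h𝒯).inter ?_)
  have : {V : ι → 𝔸 | ∀ k, ‖Q k V‖ < c k} = ⋂ k, {V | ‖Q k V‖ < c k} := by
    ext V; simp only [mem_setOf_eq, mem_iInter]
  rw [this]
  exact polarConvex_iInter fun k => polarConvex_normLt (hQ k) (c k)

/-- THE LINEAGE'S OWN MODEL SPACE: `TubeCfg ι 𝔸 α` cut by strict bi-covariant norm conditions is tube-chain-connected.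
[folklore] -/
theorem tubeChainConnected_tubeCfg_condSet [Fintype S] {a : ℝ} (ha : 0 < a) (α : ℝ) {K : Sort*}
    {Q : K → (ι → 𝔸) → 𝔸} {x y : K → S} (hQ : ∀ k, BiCov γ (Q k) (x k) (y k)) (c : K → ℝ) :
    TubeChainConnected γ a (TubeCfg ι 𝔸 α ∩ {V | ∀ k, ‖Q k V‖ < c k}) := by
  refine tubeChainConnected_of_polarConvex ha ((polarConvex_tubeCfg α).inter ?_)
  have : {V : ι → 𝔸 | ∀ k, ‖Q k V‖ < c k} = ⋂ k, {V | ‖Q k V‖ < c k} := by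
    ext V; simp only [mem_setOf_eq, mem_iInter]
  rw [this]
  exact polarConvex_iInter fun k => polarConvex_normLt (hQ k) (c k)

end Chain


/-! ## §5. End to end: (R3)/(R4) of [II] p. 22 for polar-convex condition sets, from (R1) + analyticity alone -/

section EndToEnd

variable {ι S : Type*} {𝔸 : Type*} [CStarAlgebra 𝔸] (γ : Ends ι S)

/-- **[II] p. 22, «This means … constant on intersections of orbits with the corresponding space», FOR POLAR-CONVEX
SPACES — no connectedness hypothesis left.**  (R1) `hG` on the space + *«analytic functions»* `hF` with the
near-orbits inside the analyticity domain `hmaps` ⇒ (R3): the expression is constant on orbit ∩ space.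
[cite: Balaban1988RG2Cluster, pp.21–22] for the claim; the mechanism (three lines + polar chain) is folklore and is
NOT asserted to be the author's. -/
theorem orbitConstOn_of_polarConvex [Fintype S] [Fintype ι] {a : ℝ} (ha : 0 < a) {𝒞 : Set (ι → 𝔸)} (h𝒞 : PolarConvex γ 𝒞)
    {F : (ι → 𝔸) → ℂ} {𝒟 : Set (ι → 𝔸)} (hF : DifferentiableOn ℂ F 𝒟)
    (hmaps : ∀ V ∈ 𝒞, ∀ u ∈ TubeCfg S 𝔸 a, gaugeAct γ u V ∈ 𝒟)
    (hG : ∀ V ∈ 𝒞, ∀ u : S → 𝔸, (∀ x, u x ∈ unitary 𝔸) → F (gaugeAct γ u V) = F V) : OrbitConstOn γ F 𝒞 :=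
  orbitConstOn_of_gInvariant γ hF hmaps hG (tubeChainConnected_of_polarConvex ha h𝒞)

/-- **(R4) «We extend them to constant functions on whole orbits having non-empty intersections with the space»** for
polar-convex spaces: the orbit-constant extension exists. [cite: Balaban1988RG2Cluster, p.22] -/
theorem exists_orbitExtension_of_polarConvex [Fintype S] [Fintype ι] {a : ℝ} (ha : 0 < a) {𝒞 : Set (ι → 𝔸)} (h𝒞 : PolarConvex γ 𝒞)
    {F : (ι → 𝔸) → ℂ} {𝒟 : Set (ι → 𝔸)} (hF : DifferentiableOn ℂ F 𝒟)
    (hmaps : ∀ V ∈ 𝒞, ∀ u ∈ TubeCfg S 𝔸 a, gaugeAct γ u V ∈ 𝒟)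
    (hG : ∀ V ∈ 𝒞, ∀ u : S → 𝔸, (∀ x, u x ∈ unitary 𝔸) → F (gaugeAct γ u V) = F V) :
    ∃ Fext : Cfg γ 𝔸 → ℂ, (∀ (g : S → 𝔸ˣ) (V : Cfg γ 𝔸), Fext (g • V) = Fext V) ∧ ∀ V ∈ 𝒞, Fext V = F V :=
  B13Inv214Orbit.exists_orbitExtension γ F 𝒞 (orbitConstOn_of_polarConvex γ ha h𝒞 hF hmaps hG)

/-- **THE TYPED SHAPE OF [I] p. 262 (ii, tube clause) + (iii).**  Index set `ι` = the bonds of `X` together with the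
(loop-)indices carrying `J`; `bonds ⊆ ι` carry the tube condition `V_b ∈ Tube 𝔸 α₁` («U′ = exp iξA′, |A′| < α₁»),
a family of plaquette holonomies `hol p` — any bi-covariant quantities of diagonal charge — carries «|∂U − 1| < α₀ξ²»,
and `Jidx ⊆ ι` carries «|J| < γ₀».  This condition set is tube-chain-connected, … [cite: Balaban1987RG1, p.262
(1.13), (1.14)] for the conditions; [folklore] for the conclusion. -/
theorem tubeChainConnected_p262Shape [Fintype S] {a : ℝ} (ha : 0 < a) (bonds : Set ι) (α₁ : ℝ) {P : Sort*}
    {hol : P → (ι → 𝔸) → 𝔸} {xp : P → S} (hhol : ∀ p, BiCov γ (hol p) (xp p) (xp p)) (α₀ : P → ℝ)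
    (Jidx : Set ι) (γ₀ : ℝ) :
    TubeChainConnected γ a ({V | ∀ b ∈ bonds, V b ∈ Tube 𝔸 α₁} ∩ {V | ∀ p, ‖hol p V - 1‖ < α₀ p} ∩
      {V | ∀ b ∈ Jidx, ‖V b‖ < γ₀}) := by
  refine tubeChainConnected_of_polarConvex ha (((polarConvex_tubeOn bonds α₁).inter ?_).inter ?_)
  · have : {V : ι → 𝔸 | ∀ p, ‖hol p V - 1‖ < α₀ p} = ⋂ p, {V | ‖hol p V - 1‖ < α₀ p} := by
      ext V; simp only [mem_setOf_eq, mem_iInter]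
    rw [this]
    exact polarConvex_iInter fun p => polarConvex_normLt ((hhol p).sub_one) (α₀ p)
  · have : {V : ι → 𝔸 | ∀ b ∈ Jidx, ‖V b‖ < γ₀} = ⋂ b ∈ Jidx, {V : ι → 𝔸 | ‖V b‖ < γ₀} := by
      ext V; simp only [mem_setOf_eq, mem_iInter]
    rw [this]
    exact polarConvex_iInter fun b => polarConvex_iInter fun _ => polarConvex_normLt (biCov_apply b) γ₀

/-- … hence (R3) holds on it from (R1) + analyticity alone. [cite: Balaban1988RG2Cluster, p.22;
Balaban1987RG1, p.262] -/
theorem orbitConstOn_p262Shape [Fintype S] [Fintype ι] {a : ℝ} (ha : 0 < a) (bonds : Set ι) (α₁ : ℝ) {P : Sort*}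
    {hol : P → (ι → 𝔸) → 𝔸} {xp : P → S} (hhol : ∀ p, BiCov γ (hol p) (xp p) (xp p)) (α₀ : P → ℝ)
    (Jidx : Set ι) (γ₀ : ℝ) {F : (ι → 𝔸) → ℂ} {𝒟 : Set (ι → 𝔸)} (hF : DifferentiableOn ℂ F 𝒟)
    (hmaps : ∀ V ∈ ({V | ∀ b ∈ bonds, V b ∈ Tube 𝔸 α₁} ∩ {V | ∀ p, ‖hol p V - 1‖ < α₀ p} ∩
      {V | ∀ b ∈ Jidx, ‖V b‖ < γ₀}), ∀ u ∈ TubeCfg S 𝔸 a, gaugeAct γ u V ∈ 𝒟)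
    (hG : ∀ V ∈ ({V | ∀ b ∈ bonds, V b ∈ Tube 𝔸 α₁} ∩ {V | ∀ p, ‖hol p V - 1‖ < α₀ p} ∩
      {V | ∀ b ∈ Jidx, ‖V b‖ < γ₀}), ∀ u : S → 𝔸, (∀ x, u x ∈ unitary 𝔸) → F (gaugeAct γ u V) = F V) :
    OrbitConstOn γ F ({V | ∀ b ∈ bonds, V b ∈ Tube 𝔸 α₁} ∩ {V | ∀ p, ‖hol p V - 1‖ < α₀ p} ∩
      {V | ∀ b ∈ Jidx, ‖V b‖ < γ₀}) :=
  orbitConstOn_of_gInvariant γ hF hmaps hG (tubeChainConnected_p262Shape γ ha bonds α₁ hhol α₀ Jidx γ₀)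

/-- A square plaquette word `V_{b₁} V_{b₂} V_{b₃}⁻¹ V_{b₄}⁻¹` with matching endpoints is bi-covariant of diagonal charge
— so «|∂U − 1| < α₀ξ²» is an admissible `hol` above. [folklore] -/
theorem biCov_plaquette (b₁ b₂ b₃ b₄ : ι) (h₁₂ : γ.tgt b₁ = γ.src b₂) (h₂₃ : γ.tgt b₂ = γ.tgt b₃)
    (h₃₄ : γ.src b₃ = γ.tgt b₄) (h₄₁ : γ.src b₄ = γ.src b₁) :
    BiCov γ (fun V : ι → 𝔸 => V b₁ * V b₂ * Ring.inverse (V b₃) * Ring.inverse (V b₄)) (γ.src b₁) (γ.src b₁) := by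
  have h := ((((biCov_apply (γ := γ) (𝔸 := 𝔸) b₁).mul (h₁₂ ▸ biCov_apply (γ := γ) b₂)).mul
    (h₂₃ ▸ biCov_inverse (γ := γ) b₃)).mul (h₃₄ ▸ biCov_inverse (γ := γ) b₄))
  rw [h₄₁] at h
  exact h

end EndToEnd

/-! ## §6. Negative toy: without polar convexity the conclusion FAILS — the connectedness input is necessary -/

section Toys

open B13Inv214Orbit (toyEnds toy_gaugeAct)

/-- The toy condition set: `|V| < ½` OR `|V| > 2` — a UNION of two bi-covariant norm conditions (`‖V‖ < ½`,
`‖V⁻¹‖ < ½`), one bond `true → false`, `𝔸 = ℂ`. [folklore] -/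
def toyS : Set (Unit → ℂ) := {V | ‖V ()‖ < 1 / 2} ∪ {V | 2 < ‖V ()‖}

/-- The toy expression: `0` on `|V| < 1`, `1` elsewhere. [folklore] -/
noncomputable def toyF (V : Unit → ℂ) : ℂ := if ‖V ()‖ < 1 then 0 else 1

/-- Its analyticity domain: `|V| ≠ 1`, an open set on which `toyF` is locally constant. [folklore] -/
def toyD : Set (Unit → ℂ) := {V | ‖V ()‖ < 1} ∪ {V | 1 < ‖V ()‖}

/-- `toyF` is holomorphic on `toyD`. [folklore] -/
theorem toyF_differentiableOn : DifferentiableOn ℂ toyF toyD := by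
  intro V hV
  have hc : Continuous fun W : Unit → ℂ => ‖W ()‖ := (continuous_apply ()).norm
  rcases hV with hV | hV
  · have hev : toyF =ᶠ[𝓝 V] fun _ => 0 := by
      filter_upwards [(isOpen_lt hc continuous_const).mem_nhds hV] with W hW
      simp only [toyF, if_pos (show ‖W ()‖ < 1 from hW)]
    exact ((differentiableAt_const (0 : ℂ)).congr_of_eventuallyEq hev).differentiableWithinAt
  · have hev : toyF =ᶠ[𝓝 V] fun _ => 1 := by
      filter_upwards [(isOpen_lt continuous_const hc).mem_nhds hV] with W hW
      simp only [toyF, if_neg (not_lt.2 (le_of_lt (show 1 < ‖W ()‖ from hW)))]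
    exact ((differentiableAt_const (1 : ℂ)).congr_of_eventuallyEq hev).differentiableWithinAt

/-- Norm bounds for tube-valued scalars: `e^{−a} < |exp(B)U| < e^{a}`. [folklore] -/
theorem toy_norm_bounds {a : ℝ} {z : ℂ} (hz : z ∈ Tube ℂ a) : Real.exp (-a) < ‖z‖ ∧ ‖z‖ < Real.exp a := by
  obtain ⟨B, U, hB, hU, rfl⟩ := hz
  have hU1 : ‖U‖ = 1 := CStarRing.norm_of_mem_unitary hU
  rw [norm_mul, hU1, mul_one]
  have hup : ‖exp B‖ < Real.exp a := (QuantumLattice.norm_exp_le ℂ B).trans_lt (Real.exp_lt_exp.2 hB)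
  have hup' : ‖exp (-B)‖ < Real.exp a :=
    (QuantumLattice.norm_exp_le ℂ (-B)).trans_lt (by rw [norm_neg]; exact Real.exp_lt_exp.2 hB)
  refine ⟨?_, hup⟩
  have h1 : (1 : ℝ) ≤ ‖exp B‖ * ‖exp (-B)‖ := by
    have : exp B * exp (-B) = 1 := by
      rw [← exp_add_of_commute (Commute.refl B).neg_right, add_neg_cancel, exp_zero]
    calc (1 : ℝ) = ‖exp B * exp (-B)‖ := by rw [this, norm_one]
      _ ≤ ‖exp B‖ * ‖exp (-B)‖ := norm_mul_le _ _
  by_contra hle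
  rw [not_lt] at hle
  have : ‖exp B‖ * ‖exp (-B)‖ < Real.exp (-a) * Real.exp a :=
    mul_lt_mul' hle hup' (norm_nonneg _) (Real.exp_pos _)
  rw [← Real.exp_add, neg_add_cancel, Real.exp_zero] at this
  linarith

/-- The toy action of a `Gᶜ`-valued `g`: `(g • V)() = g(tt)·V()·g(ff)⁻¹`. [folklore] -/
theorem toy_smul (g : Bool → ℂˣ) (V : Cfg toyEnds ℂ) :
    (g • V) () = (g true : ℂ) * V () * ((g false)⁻¹ : ℂˣ) := rfl

/-- A tube-valued `h` (half-width `a`) moves `|V|` by a factor in `[e^{−2a}, e^{2a}]`. [folklore] -/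
theorem toy_smul_norm_le {a : ℝ} {h : Bool → ℂˣ} (hh : (fun x => (h x : ℂ)) ∈ TubeCfg Bool ℂ a)
    (V : Cfg toyEnds ℂ) :
    ‖(h • V) ()‖ ≤ Real.exp (2 * a) * ‖V ()‖ ∧ ‖V ()‖ ≤ Real.exp (2 * a) * ‖(h • V) ()‖ := by
  have ht := toy_norm_bounds (mem_tubeCfg.1 hh true)
  have hf := toy_norm_bounds (mem_tubeCfg.1 hh false)
  have ht0 : 0 < ‖(h true : ℂ)‖ := (Real.exp_pos _).trans ht.1
  have hf0 : 0 < ‖(h false : ℂ)‖ := (Real.exp_pos _).trans hf.1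
  have he2 : Real.exp a * Real.exp a = Real.exp (2 * a) := by rw [← Real.exp_add, two_mul]
  have hinv : ∀ {r : ℝ}, Real.exp (-a) < r → r⁻¹ < Real.exp a := fun hr => by
    have := inv_strictAnti₀ (Real.exp_pos (-a)) hr
    rwa [Real.exp_neg, inv_inv] at this
  have hnorm : ‖(h • V) ()‖ = ‖(h true : ℂ)‖ * ‖V ()‖ * ‖(h false : ℂ)‖⁻¹ := by
    rw [toy_smul, norm_mul, norm_mul, Units.val_inv_eq_inv_val, norm_inv]
  constructor
  · rw [hnorm]
    calc ‖(h true : ℂ)‖ * ‖V ()‖ * ‖(h false : ℂ)‖⁻¹ ≤ Real.exp a * ‖V ()‖ * Real.exp a :=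
          mul_le_mul (mul_le_mul_of_nonneg_right ht.2.le (norm_nonneg _)) (hinv hf.1).le
            (inv_nonneg.2 (norm_nonneg _)) (by positivity)
      _ = Real.exp (2 * a) * ‖V ()‖ := by rw [← he2]; ring
  · have hV : ‖V ()‖ = ‖(h true : ℂ)‖⁻¹ * ‖(h • V) ()‖ * ‖(h false : ℂ)‖ := by
      rw [hnorm]; field_simp
    rw [hV]
    calc ‖(h true : ℂ)‖⁻¹ * ‖(h • V) ()‖ * ‖(h false : ℂ)‖ ≤ Real.exp a * ‖(h • V) ()‖ * Real.exp a :=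
          mul_le_mul (mul_le_mul_of_nonneg_right (hinv ht.1).le (norm_nonneg _)) hf.2.le (norm_nonneg _)
            (by positivity)
      _ = Real.exp (2 * a) * ‖(h • V) ()‖ := by rw [← he2]; ring

/-- Consequently, for `e^{2a} ≤ 2`, a tube-valued `h` maps `|V| < ½` into `|·| < 1` and `|V| > 2` into `|·| > 1`.
[folklore] -/
theorem toy_smul_mem_toyD {a : ℝ} (ha2 : Real.exp (2 * a) ≤ 2) {h : Bool → ℂˣ}
    (hh : (fun x => (h x : ℂ)) ∈ TubeCfg Bool ℂ a) (V : Cfg toyEnds ℂ) (hV : V ∈ toyS) :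
    (‖V ()‖ < 1 / 2 ∧ ‖(h • V) ()‖ < 1) ∨ (2 < ‖V ()‖ ∧ 1 < ‖(h • V) ()‖) := by
  have hb := toy_smul_norm_le hh V
  have he0 : 0 < Real.exp (2 * a) := Real.exp_pos _
  rcases hV with hV | hV
  · have hV' : ‖V ()‖ < 1 / 2 := hV
    refine Or.inl ⟨hV', hb.1.trans_lt ?_⟩
    calc Real.exp (2 * a) * ‖V ()‖ < Real.exp (2 * a) * (1 / 2) := by gcongr
      _ ≤ 1 := by linarith
  · have hV' : 2 < ‖V ()‖ := hV
    refine Or.inr ⟨hV', ?_⟩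
    by_contra hle
    rw [not_lt] at hle
    have : ‖V ()‖ ≤ 2 := hb.2.trans (by nlinarith [norm_nonneg ((h • V) ())])
    linarith

/-- (T1) **NOT orbit-constant**: `V ≡ ¼` and `g = (16, 1)` give `g • V ≡ 4`; both lie in `toyS`, and `toyF` jumps
`0 → 1`. [folklore] -/
theorem toy_not_orbitConstOn : ¬ OrbitConstOn toyEnds toyF toyS := by
  intro h
  have h16 : (16 : ℂ) ≠ 0 := by norm_num
  let g : Bool → ℂˣ := fun x => bif x then Units.mk0 (16 : ℂ) h16 else 1
  let V : Cfg toyEnds ℂ := fun _ => (1 / 4 : ℂ)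
  have hV4 : V () = 1 / 4 := rfl
  have hgV : (g • V) () = 4 := by
    rw [toy_smul, hV4]
    show (16 : ℂ) * (1 / 4) * ((1 : ℂˣ)⁻¹ : ℂˣ) = 4
    rw [inv_one, Units.val_one]; norm_num
  have hVS : V ∈ toyS := Or.inl (by show ‖V ()‖ < 1 / 2; rw [hV4]; norm_num)
  have hgVS : g • V ∈ toyS := Or.inr (by show 2 < ‖(g • V) ()‖; rw [hgV]; norm_num)
  have := h g V hVS hgVS
  have hF1 : toyF (g • V) = 1 := by rw [toyF, hgV, if_neg (by norm_num)]
  have hF0 : toyF V = 0 := by rw [toyF, hV4, if_pos (by norm_num)]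
  rw [hF1, hF0] at this
  exact one_ne_zero this

/-- (T2) yet **near-orbit constant** for every tube half-width `a` with `e^{2a} ≤ 2`: a tube-valued `h` moves `|V|` by
a factor in `[e^{−2a}, e^{2a}]`, which cannot cross from `|V| < ½` or `|V| > 2` over the jump at `|V| = 1`. [folklore] -/
theorem toy_nearOrbitConstOn {a : ℝ} (ha2 : Real.exp (2 * a) ≤ 2) : NearOrbitConstOn toyEnds a toyF toyS := by
  intro h V hh hV _
  rcases toy_smul_mem_toyD ha2 hh V hV with ⟨hV1, hhV1⟩ | ⟨hV1, hhV1⟩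
  · simp only [toyF, if_pos hhV1, if_pos (show ‖V ()‖ < 1 by linarith)]
  · simp only [toyF, if_neg (not_lt.2 hhV1.le), if_neg (show ¬ ‖V ()‖ < 1 from not_lt.2 (by linarith))]

/-- (T3) hence `toyS` is **NOT tube-chain-connected** for any `a` with `e^{2a} ≤ 2` (else (T2) and
`B13Inv214Orbit.orbitConstOn_of_nearOrbitConstOn` would contradict (T1)): the connectedness input behind «This means»
is NECESSARY, and UNIONS of bi-covariant norm conditions need not have it. [folklore] -/
theorem toy_not_tubeChainConnected {a : ℝ} (ha2 : Real.exp (2 * a) ≤ 2) : ¬ TubeChainConnected toyEnds a toyS :=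
  fun hconn => toy_not_orbitConstOn (orbitConstOn_of_nearOrbitConstOn toyEnds (toy_nearOrbitConstOn ha2) hconn)

/-- (T4) and `toyS` is **NOT polar-convex** (by the polar chain theorem at `a = ½ log 2`). [folklore] -/
theorem toy_not_polarConvex : ¬ PolarConvex toyEnds toyS := by
  intro h
  have ha : 0 < Real.log 2 / 2 := by
    have := Real.log_pos (by norm_num : (1 : ℝ) < 2); positivity
  have ha2 : Real.exp (2 * (Real.log 2 / 2)) ≤ 2 := by
    rw [mul_div_cancel₀ _ (two_ne_zero' ℝ), Real.exp_log (by norm_num : (0 : ℝ) < 2)]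
  exact toy_not_tubeChainConnected ha2 (tubeChainConnected_of_polarConvex ha h)

/-- (T5) while (R1) holds for the toy: `toyF` is invariant under EVERY unitary-valued gauge transformation (norms are
preserved) … [folklore] -/
theorem toy_gInvariant (u : Bool → ℂ) (hu : ∀ x, u x ∈ unitary ℂ) (V : Unit → ℂ) :
    toyF (gaugeAct toyEnds u V) = toyF V := by
  have hn : ∀ x, ‖u x‖ = 1 := fun x => CStarRing.norm_of_mem_unitary (hu x)
  have : ‖gaugeAct toyEnds u V ()‖ = ‖V ()‖ := by
    rw [toy_gaugeAct]; simp [hn]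
  simp only [toyF, this]

/-- (T6) … and the near-orbits of `toyS` stay inside the analyticity domain `toyD` (`e^{2a} ≤ 2`): EVERY hypothesis
of `orbitConstOn_of_polarConvex` / `B13Inv214Orbit.orbitConstOn_of_gInvariant` other than polar convexity /
`TubeChainConnected` is met by the toy (`toyF_differentiableOn`, `toy_hmaps`, `toy_gInvariant`), and the conclusion
FAILS (T1). [folklore] -/
theorem toy_hmaps {a : ℝ} (ha2 : Real.exp (2 * a) ≤ 2) :
    ∀ V ∈ toyS, ∀ u ∈ TubeCfg Bool ℂ a, gaugeAct toyEnds u V ∈ toyD := by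
  intro V hV u hu
  obtain ⟨w, hw⟩ : ∃ w : Bool → ℂˣ, (fun x => (w x : ℂ)) = u :=
    ⟨fun x => (isUnit_of_mem_tube (mem_tubeCfg.1 hu x)).unit, funext fun x => IsUnit.unit_spec _⟩
  subst hw
  rw [← smul_eq_gaugeAct toyEnds w V]
  rcases toy_smul_mem_toyD ha2 hu V hV with ⟨-, h1⟩ | ⟨-, h1⟩
  · exact Or.inl h1
  · exact Or.inr h1

/-- (T7) The toy in one line: all located inputs of [II] p. 22 hold, the conclusion (R3) fails. [folklore] -/
theorem toy_summary {a : ℝ} (ha2 : Real.exp (2 * a) ≤ 2) :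
    DifferentiableOn ℂ toyF toyD ∧ (∀ V ∈ toyS, ∀ u ∈ TubeCfg Bool ℂ a, gaugeAct toyEnds u V ∈ toyD) ∧
      (∀ V ∈ toyS, ∀ u : Bool → ℂ, (∀ x, u x ∈ unitary ℂ) → toyF (gaugeAct toyEnds u V) = toyF V) ∧
      NearOrbitConstOn toyEnds a toyF toyS ∧ ¬ TubeChainConnected toyEnds a toyS ∧ ¬ PolarConvex toyEnds toyS ∧
      ¬ OrbitConstOn toyEnds toyF toyS :=
  ⟨toyF_differentiableOn, toy_hmaps ha2, fun V _ u hu => toy_gInvariant u hu V, toy_nearOrbitConstOn ha2,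
    toy_not_tubeChainConnected ha2, toy_not_polarConvex, toy_not_orbitConstOn⟩

end Toys

/-! ## §7. (v1.1, append-only) The join on the tube model with `B10Eq26SiteGauge`: explicit margins; (R3)/(R4) on
## `TubeCfg` from (26) + holomorphy alone -/

section TubeModel

open B10Eq26SiteGauge (MapsTube SiteGaugeInv nearOrbitConstOn_tube)

variable {ι S : Type*} {𝔸 : Type*} [CStarAlgebra 𝔸] (γ : Ends ι S)

/-- **EXPLICIT MARGINS** for the b10 lineage's margin property: if `0 < a₀`, `0 < c` and `c + a₀ + c ≤ a`, every
transformation of the `c`-tube maps the `a₀`-tube of configurations into the `a`-tube — from the annulus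
characterisation `coe_mem_tube_iff` (‖·‖ and ‖·⁻¹‖ of the three factors) and submultiplicativity; compare
`B10Eq26SiteGauge.exists_mapsTube` (some margins, radius from the open-mapping theorem). [folklore] -/
theorem mapsTube_of_le {a a₀ c : ℝ} (ha₀ : 0 < a₀) (hc : 0 < c) (h : c + a₀ + c ≤ a) : MapsTube 𝔸 γ a a₀ c := by
  intro u hu V hV b
  have ha : 0 < a := by linarith
  obtain ⟨x, hx⟩ := isUnit_of_mem_tube (mem_tubeCfg.1 hu (γ.src b))
  obtain ⟨z, hz⟩ := isUnit_of_mem_tube (mem_tubeCfg.1 hu (γ.tgt b))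
  obtain ⟨y, hy⟩ := isUnit_of_mem_tube (mem_tubeCfg.1 hV b)
  have hxT := (coe_mem_tube_iff hc x).1 (hx ▸ mem_tubeCfg.1 hu (γ.src b))
  have hzT := (coe_mem_tube_iff hc z).1 (hz ▸ mem_tubeCfg.1 hu (γ.tgt b))
  have hyT := (coe_mem_tube_iff ha₀ y).1 (hy ▸ mem_tubeCfg.1 hV b)
  have hw : gaugeAct γ u V b = ((x * y * z⁻¹ : 𝔸ˣ) : 𝔸) := by
    show u (γ.src b) * V b * Ring.inverse (u (γ.tgt b)) = _
    rw [← hx, ← hy, ← hz, Ring.inverse_unit]; push_cast; rfl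
  rw [hw]
  have key : ∀ (p q r : 𝔸), ‖p‖ < Real.exp c → ‖q‖ < Real.exp a₀ → ‖r‖ < Real.exp c →
      ‖p * q * r‖ < Real.exp a := by
    intro p q r hp hq hr
    have hpq : ‖p‖ * ‖q‖ ≤ Real.exp c * Real.exp a₀ :=
      mul_le_mul hp.le hq.le (norm_nonneg _) (Real.exp_pos _).le
    calc ‖p * q * r‖ ≤ ‖p‖ * ‖q‖ * ‖r‖ :=
          (norm_mul_le _ _).trans (mul_le_mul_of_nonneg_right (norm_mul_le _ _) (norm_nonneg _))
      _ ≤ Real.exp c * Real.exp a₀ * ‖r‖ := mul_le_mul_of_nonneg_right hpq (norm_nonneg _)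
      _ < Real.exp c * Real.exp a₀ * Real.exp c := mul_lt_mul_of_pos_left hr (by positivity)
      _ = Real.exp (c + a₀ + c) := by rw [Real.exp_add, Real.exp_add]
      _ ≤ Real.exp a := Real.exp_le_exp.2 h
  refine (coe_mem_tube_iff ha _).2 ⟨?_, ?_⟩
  · have : (((x * y * z⁻¹ : 𝔸ˣ)) : 𝔸) = (x : 𝔸) * y * ((z⁻¹ : 𝔸ˣ) : 𝔸) := by push_cast; rfl
    rw [this]; exact key _ _ _ hxT.1 hyT.1 hzT.2
  · have : (((x * y * z⁻¹)⁻¹ : 𝔸ˣ) : 𝔸) = (z : 𝔸) * ((y⁻¹ : 𝔸ˣ) : 𝔸) * ((x⁻¹ : 𝔸ˣ) : 𝔸) := by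
      rw [mul_inv_rev, mul_inv_rev, inv_inv, mul_assoc]; push_cast; rfl
    rw [this]; exact key _ _ _ hzT.1 hyT.2 hxT.2

/-- The thirds: `a₀ = c = a/3` are admissible margins. [folklore] -/
theorem mapsTube_third {a : ℝ} (ha : 0 < a) : MapsTube 𝔸 γ a (a / 3) (a / 3) :=
  mapsTube_of_le γ (by positivity) (by positivity) (by linarith)

/-- **(R3) ON THE TUBE MODEL, ALL THREE LOCATED BINDERS DISCHARGED** ([II] p. 22 *«constant on intersections of orbits
with the corresponding space»* for the model space `TubeCfg ι 𝔸 a₀`): margins `MapsTube 𝔸 γ a a₀ c` (`c > 0`),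
holomorphy on the `a`-tube and (26) for all unitary-valued site-dependent transformations (`SiteGaugeInv`) give
orbit constancy on the `a₀`-tube — `B10Eq26SiteGauge.nearOrbitConstOn_tube` (hId := `tubeIdentity`, hmaps := margins)
joined with `tubeChainConnected_of_polarConvex` (the tube is polar-convex, `polarConvex_tubeCfg`).
[cite: Balaban1988RG2Cluster, p.22] for the sentence modelled; the binders are the located (26) and holomorphy. -/
theorem orbitConstOn_tube [Fintype ι] [Fintype S] {a a₀ c : ℝ} (hc : 0 < c) (hmaps : MapsTube 𝔸 γ a a₀ c)
    {F : (ι → 𝔸) → ℂ} (hF : DifferentiableOn ℂ F (TubeCfg ι 𝔸 a)) (h26 : SiteGaugeInv γ F) :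
    OrbitConstOn γ F (TubeCfg ι 𝔸 a₀) :=
  orbitConstOn_of_nearOrbitConstOn γ (nearOrbitConstOn_tube γ hc hmaps hF h26)
    (tubeChainConnected_of_polarConvex hc (polarConvex_tubeCfg (γ := γ) a₀))

/-- **THE BINDER-MINIMAL FORM**: holomorphy on the `a`-tube (`a > 0`) and (26) ALONE give orbit constancy on the
`a/3`-tube. [cite: Balaban1988RG2Cluster, p.22; Balaban1987RG1, p.283 («implied by the invariance with respect to
G-valued transformations, and by the analyticity of the function»)] -/
theorem orbitConstOn_tube_third [Fintype ι] [Fintype S] {a : ℝ} (ha : 0 < a) {F : (ι → 𝔸) → ℂ}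
    (hF : DifferentiableOn ℂ F (TubeCfg ι 𝔸 a)) (h26 : SiteGaugeInv γ F) :
    OrbitConstOn γ F (TubeCfg ι 𝔸 (a / 3)) :=
  orbitConstOn_tube γ (by positivity) (mapsTube_third γ ha) hF h26

/-- **(R4) ON THE TUBE MODEL** ([II] p. 22 *«We extend them to constant functions on whole orbits having non-empty
intersections with the space»*): under the same two hypotheses the function extends from the `a/3`-tube to an
orbit-constant function of all configurations. [cite: Balaban1988RG2Cluster, p.22] -/
theorem exists_orbitExtension_tube_third [Fintype ι] [Fintype S] {a : ℝ} (ha : 0 < a) {F : (ι → 𝔸) → ℂ}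
    (hF : DifferentiableOn ℂ F (TubeCfg ι 𝔸 a)) (h26 : SiteGaugeInv γ F) :
    ∃ Fext : Cfg γ 𝔸 → ℂ, (∀ (g : S → 𝔸ˣ) (V : Cfg γ 𝔸), Fext (g • V) = Fext V) ∧
      ∀ V ∈ TubeCfg ι 𝔸 (a / 3), Fext V = F V :=
  B13Inv214Orbit.exists_orbitExtension γ F _ (orbitConstOn_tube_third γ ha hF h26)

end TubeModel

end Literature.MathematicalPhysics.QuantumFieldTheory.Balaban1983to89.B13Inv214PolarChain
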